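import Literature.NumberTheory.EllipticCurves.HidaFamilyMembersTriangularBasisProofs
import Literature.NumberTheory.EllipticCurves.HidaFamilyMembersFlagCountProofs
import Literature.RingTheory.Valuation.AlgClosedResidue
import HarnessLib

/-!
# Hida's rank constancy implies the congruent ordinary newform of exact level `N` (proofs only)

Helper file (theorems only: no definition, no named fact; D-0026) of the seat of the named fact
`Literature.NumberTheory.EllipticCurves.hida_exists_congruent_ordinary_newform`
(`HidaFamilyMembers.lean`): the CLASSICAL REDUCTION of that fact to the Modularity Theorem
(`exists_isNewformOf`, a named fact of the tree) and to Hida's **rank constancy** (Hida,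
*Elementary Modular Iwasawa Theory* (2022), Lemma 4.1.25 = Cor. 4.2.32; Hida 1986a,b): for
`p ∤ N`, the `W`-rank of the ordinary part of `S_k(Γ₀(N p); W)` does not depend on the weight
`k ≥ 2` in a fixed class modulo `p - 1` — here carried as an explicit HYPOTHESIS, in the form
"the number of `p`-adic unit eigenvalues of `U_p` on `S_k(Γ₀(N p))`, with multiplicity, is the same
in weights `k` and `2`".  Architecture (all proved here and in the two helper files
`HidaFamilyMembersFlagCountProofs`, `HidaFamilyMembersTriangularBasisProofs`):

1. integral coordinates on `S_k(Γ₀(L))` controlled `p`-adically by `q`-expansions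
   (`exists_coordinates`: Deligne–Serre's lattice of `S_k(Γ₁(L))`, the adapted basis of
   `DeligneSerreLift.exists_adapted_basis`, `norm_repr_le`);
2. reduction modulo the maximal ideal of `𝒪 = ι(𝒪_{ℚ̄_p}) ⊆ ℂ`: the dimensions of the
   simultaneous generalised eigenspaces of the reduced Hecke operators `T_q` (`q ∤ N p`), `U_p` are
   the numbers of diagonal characters of the `U_p`-triangular Atkin–Lehner basis reducing to a given
   residual character (`finrank_iInf_maxGenEigenspace_residue_eq_card`, `exists_triangular_basis`);
3. multiplication by `E_{k-2} ≡ 1 (mod p)` is an injective intertwiner modulo `𝔪` from weight `2`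
   to weight `k ≡ 2 (mod p - 1)` (Deligne–Serre 6.9–6.10), whence residual multiplicities can only
   grow with the weight; rank constancy forces equality for the `U_p`-unit characters;
4. the count of `U_p`-unit characters with given residual eigensystem at level `N' p` is
   `∑_{M ∣ N'} σ₀(N'/M) (r_k(M) + s_k(M))` (`r_k(M)`: congruent `p`-ordinary newforms of level `M`;
   `s_k(M)`: of level `M p`, zero for `k > 2` by Miyake Thm. 4.6.17 (2)), for every `N' ∣ N`; a
   triangular induction over the divisors of `N` then gives `r_k(N) = r_2(N) + s_2(N) ≥ 1`, the
   `1` being `f_E` itself (Modularity): a `p`-ordinary newform of weight `k` and level EXACTLY `N`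
   congruent to `f_E` away from `N p`.

Main statement:
`Literature.NumberTheory.EllipticCurves.hida_exists_congruent_ordinary_newform_of_exists_isNewformOf_of_rank_constancy`.
[cite: Hida2022EMI, Lemma 4.1.25, Cor. 4.2.32] [cite: Hida1986, Thm. 1.1–1.2]
[cite: DeligneSerreASENS1974, 6.9–6.11] [cite: DiamondShurman2005, Prop. 5.6.2, Thm. 5.8.3]
-/

noncomputable section

open scoped MatrixGroups ModularForm
open CongruenceSubgroup UpperHalfPlane Module IsLocalRing Matrix

namespace Literature.NumberTheory.EllipticCurves.ModularForms.HidaRank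

/-! ### The valuation ring `𝒪 = ι(𝒪_{ℚ̄_p}) ⊆ ℂ` -/

section Oc

variable {p : ℕ} [Fact p.Prime]

/-- There is a valuation subring of `ℂ` which is the closed unit ball of `|ι⁻¹ ·|_p`. [folklore] -/
theorem exists_valuationSubring_norm (ι : PadicAlgCl p ≃+* ℂ) :
    ∃ O : ValuationSubring ℂ, ∀ x, x ∈ O ↔ ‖ι.symm x‖ ≤ 1 :=
  ⟨(Valued.v (R := PadicAlgCl p)).valuationSubring.comap (ι.symm : ℂ →+* PadicAlgCl p), fun x ↦ by
    rw [ValuationSubring.mem_comap]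
    exact Automorphic.PadicAlgCl.mem_valuationSubring_iff p _⟩

variable (ι : PadicAlgCl p ≃+* ℂ) {O : ValuationSubring ℂ} (hO : ∀ x, x ∈ O ↔ ‖ι.symm x‖ ≤ 1)
include hO

/-- The maximal ideal of `𝒪` is the open unit ball. [folklore] -/
theorem mem_maximalIdeal_iff_norm (x : O) : x ∈ maximalIdeal O ↔ ‖ι.symm (x : ℂ)‖ < 1 := by
  rw [IsLocalRing.mem_maximalIdeal, mem_nonunits_iff]
  constructor
  · intro h
    by_contra hlt
    have h1 : ‖ι.symm (x : ℂ)‖ = 1 := le_antisymm ((hO _).mp x.2) (not_lt.mp hlt)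
    have hx0 : (x : ℂ) ≠ 0 := fun h0 ↦ by
      rw [h0, map_zero, norm_zero] at h1; exact zero_ne_one h1
    have hinv : (x : ℂ)⁻¹ ∈ O := by rw [hO, map_inv₀, norm_inv, h1, inv_one]
    exact h ⟨⟨x, ⟨(x : ℂ)⁻¹, hinv⟩, Subtype.ext (mul_inv_cancel₀ hx0),
      Subtype.ext (inv_mul_cancel₀ hx0)⟩, rfl⟩
  · intro h hu
    obtain ⟨u, hu⟩ := hu
    have h1 : ‖ι.symm ((u⁻¹ : Oˣ) : O)‖ ≤ 1 := (hO _).mp (u⁻¹ : Oˣ).1.2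
    have h2 : ι.symm ((u : O) : ℂ) * ι.symm (((u⁻¹ : Oˣ) : O) : ℂ) = 1 := by
      rw [← map_mul]
      have : ((u : O) : ℂ) * (((u⁻¹ : Oˣ) : O) : ℂ) = (((u * u⁻¹ : Oˣ) : O) : ℂ) := by
        push_cast; rfl
      rw [this, mul_inv_cancel u]
      simp
    have h3 : ‖ι.symm ((u : O) : ℂ)‖ * ‖ι.symm (((u⁻¹ : Oˣ) : O) : ℂ)‖ = 1 := by
      rw [← norm_mul, h2, norm_one]
    rw [hu] at h3
    nlinarith [norm_nonneg (ι.symm (((u⁻¹ : Oˣ) : O) : ℂ)), norm_nonneg (ι.symm (x : ℂ))]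

/-- Two integral elements have the same residue iff they are congruent modulo `𝔪`. [folklore] -/
theorem residue_eq_iff_norm (x y : O) : residue O x = residue O y ↔ ‖ι.symm (x : ℂ) - ι.symm (y : ℂ)‖ < 1 := by
  rw [← sub_eq_zero, ← map_sub, residue_eq_zero_iff, mem_maximalIdeal_iff_norm ι hO, ← map_sub]
  rfl

/-- The residue of an integral element is non-zero iff it is a unit, iff `|ι⁻¹ x| = 1`. [folklore] -/
theorem residue_ne_zero_iff_norm (x : O) : residue O x ≠ 0 ↔ ‖ι.symm (x : ℂ)‖ = 1 := by
  rw [Ne, residue_eq_zero_iff, mem_maximalIdeal_iff_norm ι hO, not_lt]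
  exact ⟨fun h ↦ le_antisymm ((hO _).mp x.2) h, fun h ↦ h.ge⟩

end Oc

/-! ### The dimension of a finite direct sum of generalised eigenspaces -/

section IndepSum

variable {K : Type*} [Field K] {V : Type*} [AddCommGroup V] [Module K V] [FiniteDimensional K V]

/-- For an independent family and a finite set of indices,
`dim ⨆_{i ∈ s} E i = ∑_{i ∈ s} dim (E i)`. [folklore] -/
theorem finrank_biSup_eq_sum_of_iSupIndep {α : Type*} (E : α → Submodule K V) (hE : iSupIndep E)
    (s : Finset α) : finrank K ↥(⨆ i ∈ s, E i) = ∑ i ∈ s, finrank K ↥(E i) := by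
  classical
  induction s using Finset.induction_on with
  | empty => simp
  | insert a s ha ih =>
    rw [Finset.iSup_insert, Finset.sum_insert ha, ← ih]
    have hdis : Disjoint (E a) (⨆ i ∈ s, E i) :=
      hE.disjoint_biSup (y := (s : Set α)) (by simpa using ha)
    have h := Submodule.finrank_sup_add_finrank_inf_eq (E a) (⨆ i ∈ s, E i)
    rw [hdis.eq_bot, finrank_bot, add_zero] at h
    exact h

/-- **The number of `p`-adic unit eigenvalues of an endomorphism, with multiplicity**, read off a
triangular form: if `f` is upper triangular in the basis `b` with diagonal `δ i`, then
`dim ⨆_{u, |ι⁻¹ u| = 1} (maximal generalised `u`-eigenspace of f) = #{i | |ι⁻¹ δ i| = 1}`.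
[folklore] -/
theorem finrank_biSup_maxGenEigenspace_eq_card {p : ℕ} [Fact p.Prime] (ι : PadicAlgCl p ≃+* ℂ)
    {V : Type*} [AddCommGroup V] [Module ℂ V] [FiniteDimensional ℂ V] {n : ℕ}
    (b : Module.Basis (Fin n) ℂ V) (f : Module.End ℂ V) (δ : Fin n → ℂ)
    (htri : ∀ i, f (b i) - δ i • b i ∈ b.flag i.castSucc) :
    finrank ℂ ↥(⨆ (u : ℂ) (_ : ‖ι.symm u‖ = 1), f.maxGenEigenspace u) =
      (Finset.univ.filter fun i ↦ ‖ι.symm (δ i)‖ = 1).card := by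
  classical
  -- single-operator count
  have hcount : ∀ u : ℂ, finrank ℂ ↥(f.maxGenEigenspace u) =
      (Finset.univ.filter fun i ↦ δ i = u).card := by
    intro u
    have h := finrank_iInf_maxGenEigenspace_eq_card (τ := Unit) b (fun _ ↦ f) (fun i _ ↦ δ i)
      (fun _ i ↦ htri i) (fun _ _ ↦ Commute.refl _) (fun _ ↦ u)
    rw [iInf_const] at h
    rw [h]
    congr 1
    ext i
    simp only [Finset.mem_filter, Finset.mem_univ, true_and]
    exact ⟨fun h ↦ congrFun h (), fun h ↦ funext fun _ ↦ h⟩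
  -- only the diagonal entries contribute
  set Θ : Finset ℂ := (Finset.univ.image δ).filter fun u ↦ ‖ι.symm u‖ = 1 with hΘ
  have hzero : ∀ u, u ∉ Finset.univ.image δ → f.maxGenEigenspace u = ⊥ := by
    intro u hu
    have h := hcount u
    have h0 : (Finset.univ.filter fun i ↦ δ i = u).card = 0 := by
      rw [Finset.card_eq_zero, Finset.filter_eq_empty_iff]
      intro i _ hi
      exact hu (Finset.mem_image.mpr ⟨i, Finset.mem_univ _, hi⟩)
    rw [h0] at h
    exact Submodule.finrank_eq_zero.mp h
  have hsup : (⨆ (u : ℂ) (_ : ‖ι.symm u‖ = 1), f.maxGenEigenspace u) = ⨆ u ∈ Θ, f.maxGenEigenspace u := by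
    apply le_antisymm
    · refine iSup₂_le fun u hu ↦ ?_
      by_cases hmem : u ∈ Finset.univ.image δ
      · exact le_biSup f.maxGenEigenspace (show u ∈ Θ from Finset.mem_filter.mpr ⟨hmem, hu⟩)
      · rw [hzero u hmem]; exact bot_le
    · refine iSup₂_le fun u hu ↦ ?_
      have hu' : ‖ι.symm u‖ = 1 := (Finset.mem_filter.mp hu).2
      exact le_iSup₂ (f := fun (u : ℂ) (_ : ‖ι.symm u‖ = 1) ↦ f.maxGenEigenspace u) u hu'
  rw [hsup, finrank_biSup_eq_sum_of_iSupIndep _ f.independent_maxGenEigenspace Θ,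
    Finset.card_eq_sum_card_fiberwise (f := δ) (t := Θ) (fun i hi ↦ by
      have hi' : ‖ι.symm (δ i)‖ = 1 := by simpa using hi
      exact Finset.mem_filter.mpr ⟨Finset.mem_image_of_mem δ (Finset.mem_univ i), hi'⟩)]
  refine Finset.sum_congr rfl fun u hu ↦ ?_
  rw [hcount]
  congr 1
  ext i
  simp only [Finset.mem_filter, Finset.mem_univ, true_and, iff_and_self]
  intro hi
  rw [hi]
  exact (Finset.mem_filter.mp hu).2

end IndepSum

/-! ### A triangular system over the divisors of `N` -/

/-- **Triangular induction over divisors**: if `∑_{M ∣ N'} σ₀(N'/M) g(M) = 0` for every divisor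
`N'` of `N`, then `g(N') = 0` for every divisor `N'` of `N` (the coefficient of `g(N')` is
`σ₀(1) = 1`). [folklore] -/
theorem eq_zero_of_sum_divisors_card_mul_eq_zero {N : ℕ} (hN : N ≠ 0) (g : ℕ → ℤ)
    (h : ∀ N', N' ∣ N → ∑ M ∈ N'.divisors, ((N' / M).divisors.card : ℤ) * g M = 0) :
    ∀ N', N' ∣ N → g N' = 0 := by
  intro N'
  induction N' using Nat.strong_induction_on with
  | _ N' ih =>
    intro hN'
    have hN'0 : N' ≠ 0 := fun h0 ↦ hN (Nat.eq_zero_of_zero_dvd (h0 ▸ hN'))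
    have hsum := h N' hN'
    rw [← Finset.add_sum_erase _ _ (Nat.mem_divisors_self N' hN'0), Nat.div_self (Nat.pos_of_ne_zero hN'0),
      Nat.divisors_one, Finset.card_singleton, Nat.cast_one, one_mul] at hsum
    have hrest : ∑ M ∈ N'.divisors.erase N', ((N' / M).divisors.card : ℤ) * g M = 0 := by
      refine Finset.sum_eq_zero fun M hM ↦ ?_
      obtain ⟨hMne, hMdiv⟩ := Finset.mem_erase.mp hM
      have hMd : M ∣ N' := Nat.dvd_of_mem_divisors hMdiv
      have hMlt : M < N' := lt_of_le_of_ne (Nat.le_of_dvd (Nat.pos_of_ne_zero hN'0) hMd) hMne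
      rw [ih M hMlt (hMd.trans hN'), mul_zero]
    rwa [hrest, add_zero] at hsum

/-! ### Integral coordinates on `S_k(Γ₀(L))` -/

section Coordinates

variable {p : ℕ} [Fact p.Prime]

set_option maxHeartbeats 1600000 in
/-- **Integral coordinates on `S_k(Γ₀(L))` controlled `p`-adically by `q`-expansions** (`L ≥ 1`,
`k ≥ 1`, `ι : ℚ̄_p ≃ ℂ`).  There are a finite index set `J`, coordinates
`crd : S_k(Γ₁(L)) → ℂ^J` inducing an isomorphism `Φ : S_k(Γ₀(L)) ≅ ℂ^J` through `liftToGamma1`,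
the corresponding basis vectors `bv j ∈ S_k(Γ₀(L))` (`Φ (bv j) = e_j`), which have INTEGER Fourier
coefficients, and integer matrices `Mz q` giving the Hecke operators `T_q` (`q` prime; `U_q` for
`q ∣ L`) on the `⟨d⟩`-invariant forms of `S_k(Γ₁(L))` in these coordinates; and the coordinates of
a `⟨d⟩`-invariant form whose coefficients have `|ι⁻¹ ·| ≤ r` (resp. `< r`) have `|ι⁻¹ ·| ≤ r`
(resp. `< r`).  This is Deligne–Serre's lattice of integral forms (Prop. 2.7) with the adapted
basis of `DeligneSerreLift.exists_adapted_basis` for the fixed space of the diamond operators, and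
the adjugate bound `DeligneSerreLift.norm_repr_le`. [cite: DeligneSerreASENS1974, Prop. 2.7] -/
theorem exists_coordinates (ι : PadicAlgCl p ≃+* ℂ) (L : ℕ) [NeZero L] (κ : ℤ) (hκ : 1 ≤ κ) :
    ∃ (J : Type) (_ : Fintype J) (_ : DecidableEq J) (Φ : CuspForm (Gamma0 L) κ ≃ₗ[ℂ] (J → ℂ))
      (crd : CuspForm (Gamma1 L) κ →ₗ[ℂ] (J → ℂ)) (bv : J → CuspForm (Gamma0 L) κ)
      (Mz : ℕ → Matrix J J ℤ),
      (∀ f, Φ f = crd (liftToGamma1 L κ f)) ∧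
      (∀ j, Φ (bv j) = Pi.single j 1) ∧
      (∀ j n, ∃ z : ℤ, (qExpansion 1 ⇑(bv j)).coeff n = z) ∧
      (∀ (q : ℕ) (hq : q.Prime) (x : CuspForm (Gamma1 L) κ),
        (∀ d : (ZMod L)ˣ, diamondOp L κ (d : ZMod L) x = x) →
        crd ((haveI : NeZero q := ⟨hq.ne_zero⟩; heckeT (Gamma1 L) κ q) x) =
          ((Mz q).map (Int.castRingHom ℂ)) *ᵥ crd x) ∧
      (∀ (x : CuspForm (Gamma1 L) κ) (r : ℝ), 0 ≤ r →
        (∀ d : (ZMod L)ˣ, diamondOp L κ (d : ZMod L) x = x) →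
        (∀ n, ‖ι.symm (cuspCoeff x n)‖ ≤ r) → ∀ j, ‖ι.symm (crd x j)‖ ≤ r) ∧
      (∀ (x : CuspForm (Gamma1 L) κ) (r : ℝ),
        (∀ d : (ZMod L)ˣ, diamondOp L κ (d : ZMod L) x = x) →
        (∀ n, ‖ι.symm (cuspCoeff x n)‖ < r) → ∀ j, ‖ι.symm (crd x j)‖ < r) ∧
      (∀ x : CuspForm (Gamma1 L) κ, (∀ d : (ZMod L)ˣ, diamondOp L κ (d : ZMod L) x = x) →
        x = ∑ j, crd x j • liftToGamma1 L κ (bv j)) := by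
  classical
  -- ### the fixed space `W` of the diamond operators and the quasi-projector `E = ∑_d ⟨d⟩`
  let Dm : (ZMod L)ˣ → Module.End ℂ (CuspForm (Gamma1 L) κ) := fun d ↦ diamondOp L κ (d : ZMod L)
  let W : Submodule ℂ (CuspForm (Gamma1 L) κ) := ⨅ d : (ZMod L)ˣ, LinearMap.ker (Dm d - 1)
  have hW : ∀ x, x ∈ W ↔ ∀ d : (ZMod L)ˣ, Dm d x = x := fun x ↦ by
    simp only [W, Submodule.mem_iInf, LinearMap.mem_ker, LinearMap.sub_apply,
      Module.End.one_apply, sub_eq_zero]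
  let E : Module.End ℂ (CuspForm (Gamma1 L) κ) := ∑ d : (ZMod L)ˣ, Dm d
  have hDm_mul : ∀ d e : (ZMod L)ˣ, Dm e * Dm d = Dm (e * d) := fun d e ↦ by
    simp only [Dm]
    rw [Units.val_mul, diamondOp_mul_holds L κ e.isUnit d.isUnit]
  have hEΛ : ∀ x ∈ integralLattice1 L κ, E x ∈ integralLattice1 L κ := fun x hx ↦ by
    simp only [E, LinearMap.sum_apply]
    exact Submodule.sum_mem _ fun d _ ↦ diamondOp_mem_integralLattice1 hx _
  have hEW : ∀ x, E x ∈ W := fun x ↦ by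
    rw [hW]
    intro e
    simp only [E, LinearMap.sum_apply, map_sum]
    have : ∀ d, Dm e (Dm d x) = Dm (e * d) x := fun d ↦ by
      rw [← Module.End.mul_apply, hDm_mul]
    simp only [this]
    exact Fintype.sum_equiv (Equiv.mulLeft e) _ _ fun d ↦ rfl
  have hE : ∃ c : ℂ, c ≠ 0 ∧ ∀ w ∈ W, E w = c • w := by
    refine ⟨Fintype.card (ZMod L)ˣ, Nat.cast_ne_zero.mpr Fintype.card_ne_zero, fun w hw ↦ ?_⟩
    rw [hW] at hw
    simp only [E, LinearMap.sum_apply, hw, Finset.sum_const, Finset.card_univ, Nat.cast_smul_eq_nsmul]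
  -- ### the adapted basis
  obtain ⟨J₁, J₂, _, _, _, _, B, hBΛ, hBint, hBW, hBrepr⟩ :=
    DeligneSerreLift.exists_adapted_basis hκ W E hEΛ hEW hE
  have hsumW : ∀ x ∈ W, ∑ j : J₁, B.repr x (Sum.inl j) • B (Sum.inl j) = x := fun x hx ↦ by
    conv_rhs => rw [← B.sum_repr x, Fintype.sum_sum_type]
    simp [hBrepr x hx]
  have hliftW : ∀ f : CuspForm (Gamma0 L) κ, liftToGamma1 L κ f ∈ W := fun f ↦ by
    rw [hW]; intro d; exact diamondOp_liftToGamma1 L κ _ f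
  have hWdiam : ∀ x, (∀ d : (ZMod L)ˣ, diamondOp L κ (d : ZMod L) x = x) ↔ x ∈ W := fun x ↦ (hW x).symm
  -- coordinates
  let crd : CuspForm (Gamma1 L) κ →ₗ[ℂ] (J₁ → ℂ) :=
    LinearMap.pi fun j ↦ (Finsupp.lapply (Sum.inl j)).comp B.repr.toLinearMap
  have hcrd : ∀ x j, crd x j = B.repr x (Sum.inl j) := fun x j ↦ rfl
  -- the basis vectors, as `Γ₀(L)`-forms
  have hbv : ∀ j : J₁, ∃ f : CuspForm (Gamma0 L) κ, liftToGamma1 L κ f = B (Sum.inl j) := by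
    intro j
    refine exists_liftToGamma1_eq_of_forall_diamondOp_eq κ (B (Sum.inl j)) fun d hd ↦ ?_
    obtain ⟨u, rfl⟩ := hd
    exact (hW _).mp (hBW j) u
  choose bv hbv using hbv
  -- ### `Φ`
  let Φ₀ : CuspForm (Gamma0 L) κ →ₗ[ℂ] (J₁ → ℂ) := crd ∘ₗ liftToGamma1 L κ
  have hΦ₀ : ∀ f, Φ₀ f = crd (liftToGamma1 L κ f) := fun f ↦ rfl
  have hΦ₀bv : ∀ j, Φ₀ (bv j) = Pi.single j 1 := by
    intro j
    ext j'
    rw [hΦ₀, hbv, hcrd, B.repr_self, Pi.single_apply, Finsupp.single_apply]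
    by_cases h : j = j'
    · subst h; simp
    · rw [if_neg (fun h' ↦ h (Sum.inl_injective h')), if_neg (Ne.symm h)]
  have hinj : Function.Injective Φ₀ := by
    rw [← LinearMap.ker_eq_bot, LinearMap.ker_eq_bot']
    intro f hf
    apply liftToGamma1_injective L κ
    rw [map_zero, ← hsumW _ (hliftW f)]
    refine Finset.sum_eq_zero fun j _ ↦ ?_
    have : crd (liftToGamma1 L κ f) j = 0 := by rw [← hΦ₀, hf]; rfl
    rw [hcrd] at this
    rw [this, zero_smul]
  have hsurj : Function.Surjective Φ₀ := by
    intro c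
    refine ⟨∑ j, c j • bv j, ?_⟩
    rw [map_sum]
    simp only [map_smul, hΦ₀bv]
    ext j'
    simp only [Finset.sum_apply, Pi.smul_apply, Pi.single_apply, smul_eq_mul, mul_ite, mul_one,
      mul_zero, Finset.sum_ite_eq, Finset.mem_univ, if_true]
  let Φ : CuspForm (Gamma0 L) κ ≃ₗ[ℂ] (J₁ → ℂ) := LinearEquiv.ofBijective Φ₀ ⟨hinj, hsurj⟩
  have hΦ : ∀ f, Φ f = Φ₀ f := fun f ↦ rfl
  -- ### the integer matrices of the Hecke operators
  have hTΛ : ∀ (q : ℕ) (hq : q.Prime) (j : J₁) (i : J₁), ∃ z : ℤ,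
      B.repr ((haveI : NeZero q := ⟨hq.ne_zero⟩; heckeT (Gamma1 L) κ q) (B (Sum.inl j))) (Sum.inl i) = z :=
    fun q hq j i ↦ by
      haveI : NeZero q := ⟨hq.ne_zero⟩
      exact hBint _ (heckeT_mem_integralLattice1 hκ (hBΛ _) q hq) (Sum.inl i)
  let Mz : ℕ → Matrix J₁ J₁ ℤ := fun q ↦ Matrix.of fun i j ↦
    if hq : q.Prime then Classical.choose (hTΛ q hq j i) else 0
  have hMz : ∀ (q : ℕ) (hq : q.Prime) (i j : J₁), ((Mz q i j : ℤ) : ℂ) =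
      B.repr ((haveI : NeZero q := ⟨hq.ne_zero⟩; heckeT (Gamma1 L) κ q) (B (Sum.inl j))) (Sum.inl i) := by
    intro q hq i j
    simp only [Mz, Matrix.of_apply, dif_pos hq]
    exact (Classical.choose_spec (hTΛ q hq j i)).symm
  have hT : ∀ (q : ℕ) (hq : q.Prime) (x : CuspForm (Gamma1 L) κ),
      (∀ d : (ZMod L)ˣ, diamondOp L κ (d : ZMod L) x = x) →
      crd ((haveI : NeZero q := ⟨hq.ne_zero⟩; heckeT (Gamma1 L) κ q) x) =
        ((Mz q).map (Int.castRingHom ℂ)) *ᵥ crd x := by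
    intro q hq x hx
    haveI : NeZero q := ⟨hq.ne_zero⟩
    have hxW : x ∈ W := (hWdiam x).mp hx
    ext i
    rw [hcrd]
    conv_lhs => rw [← hsumW x hxW]
    simp only [map_sum, map_smul, Finsupp.coe_finsetSum, Finsupp.coe_smul, Finset.sum_apply,
      Pi.smul_apply, smul_eq_mul, Matrix.mulVec, dotProduct, Matrix.map_apply, eq_intCast, hMz q hq,
      hcrd]
    exact Finset.sum_congr rfl fun j _ ↦ mul_comm _ _
  -- ### packaging
  refine ⟨J₁, inferInstance, inferInstance, Φ, crd, bv, Mz, fun f ↦ rfl, hΦ₀bv, ?_, hT, ?_, ?_, ?_⟩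
  · -- integrality of the basis vectors
    intro j n
    obtain ⟨z, hz⟩ := exists_int_eq_cuspCoeff_of_mem_integralLattice1 (hBΛ (Sum.inl j)) n
    refine ⟨z, ?_⟩
    rw [← hbv j] at hz
    rw [hz]
    change (qExpansion 1 ⇑(bv j)).coeff n = (qExpansion 1 ⇑(liftToGamma1 L κ (bv j))).coeff n
    rw [coe_liftToGamma1_holds L κ (bv j)]
  · -- `≤ r`
    intro x r hr hx h j
    rw [hcrd]
    exact DeligneSerreLift.norm_repr_le ι B hBΛ hBint x hr (fun d n ↦ by rw [hx d]; exact h n) _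
  · -- `< r`
    intro x r hx h j
    rw [hcrd]
    exact DeligneSerreLift.norm_repr_lt ι B hBΛ hBint x (fun d n ↦ by rw [hx d]; exact h n) _
  · -- reconstruction
    intro x hx
    conv_lhs => rw [← hsumW x ((hWdiam x).mp hx)]
    exact Finset.sum_congr rfl fun j _ ↦ by rw [hcrd, hbv]

end Coordinates

/-! ### Residual multiplicities as numbers of diagonal characters -/

section Residual

variable {p : ℕ} [Fact p.Prime]

set_option maxHeartbeats 1600000 in
/-- **Residual multiplicities are counted by the diagonal characters.**  Fix a level `L`, a weight
`κ`, the valuation ring `𝒪 ⊆ ℂ` of `ι`, coordinates `Φ : S_κ(Γ₀(L)) ≅ ℂ^J` in which the Hecke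
operators `T_q` (`q` prime) act by INTEGER matrices `Mz q`, and a basis `b` of `S_κ(Γ₀(L))` in
which the `T_q`, `q ∈ S` (a set of primes), are upper triangular with `p`-integral diagonal
characters `θ i`.  Then for every character `χ` of `S` with values in the residue field `k` of `𝒪`,
the simultaneous generalised eigenspace of `χ` for the REDUCED matrices `Mz q mod 𝔪` acting on `k^J`
has dimension `#{i | θ i mod 𝔪 = χ}` (decomposition numbers along the triangular form:
`finrank_iInf_maxGenEigenspace_residue_eq_card`). [folklore] -/
theorem finrank_residual_eq_card (ι : PadicAlgCl p ≃+* ℂ) {O : ValuationSubring ℂ}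
    (hO : ∀ x, x ∈ O ↔ ‖ι.symm x‖ ≤ 1) {L : ℕ} [NeZero L] {κ : ℤ} {J : Type} [Fintype J]
    [DecidableEq J] (Φ : CuspForm (Gamma0 L) κ ≃ₗ[ℂ] (J → ℂ)) (Mz : ℕ → Matrix J J ℤ)
    (hΦT : ∀ (q : ℕ) (hq : q.Prime) (f : CuspForm (Gamma0 L) κ),
      Φ ((haveI : NeZero q := ⟨hq.ne_zero⟩; heckeT (Gamma0 L) κ q) f) =
        ((Mz q).map (Int.castRingHom ℂ)) *ᵥ Φ f)
    (S : ℕ → Prop) (hS : ∀ q, S q → q.Prime) {n : ℕ} (b : Module.Basis (Fin n) ℂ (CuspForm (Gamma0 L) κ))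
    (θ : Fin n → ℕ → ℂ) (hθ : ∀ i q, S q → ‖ι.symm (θ i q)‖ ≤ 1)
    (htri : ∀ (q : ℕ) (hq : S q) (i : Fin n),
      (haveI : NeZero q := ⟨(hS q hq).ne_zero⟩; heckeT (Gamma0 L) κ q (b i)) - θ i q • b i ∈
        b.flag i.castSucc)
    (χ : {q : ℕ // S q} → ResidueField O) [DecidableEq ({q : ℕ // S q} → ResidueField O)] :
    finrank (ResidueField O) ↥(⨅ t : {q : ℕ // S q}, Module.End.maxGenEigenspace
        (Matrix.toLin' (((Mz t.1).map (Int.castRingHom O)).map (residue O))) (χ t)) =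
      (Finset.univ.filter fun i : Fin n ↦
        (fun t : {q : ℕ // S q} ↦ residue O ⟨θ i t.1, (hO _).mpr (hθ i t.1 t.2)⟩) = χ).card := by
  classical
  haveI : IsAlgClosed (ResidueField O) := Literature.RingTheory.Valuation.isAlgClosed_residueField O
  let τ := {q : ℕ // S q}
  let MO : τ → Matrix J J O := fun t ↦ (Mz t.1).map (Int.castRingHom O)
  -- the Hecke operators commute, hence so do their matrices
  have hcommC : ∀ s t : τ, (Mz s.1).map (Int.castRingHom ℂ) * (Mz t.1).map (Int.castRingHom ℂ) =
      (Mz t.1).map (Int.castRingHom ℂ) * (Mz s.1).map (Int.castRingHom ℂ) := by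
    intro s t
    haveI : NeZero s.1 := ⟨(hS _ s.2).ne_zero⟩
    haveI : NeZero t.1 := ⟨(hS _ t.2).ne_zero⟩
    apply Matrix.toLin'.injective
    apply LinearMap.ext
    intro v
    obtain ⟨f, rfl⟩ := Φ.surjective v
    rw [Matrix.toLin'_mul, Matrix.toLin'_mul, LinearMap.comp_apply, LinearMap.comp_apply,
      Matrix.toLin'_apply, Matrix.toLin'_apply, Matrix.toLin'_apply, Matrix.toLin'_apply,
      ← hΦT t.1 (hS _ t.2), ← hΦT s.1 (hS _ s.2), ← hΦT s.1 (hS _ s.2), ← hΦT t.1 (hS _ t.2),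
      ← Module.End.mul_apply, heckeT_comm_gamma0_holds L κ s.1 t.1, Module.End.mul_apply]
  have hcommZ : ∀ s t : τ, Mz s.1 * Mz t.1 = Mz t.1 * Mz s.1 := by
    intro s t
    apply Matrix.map_injective (f := Int.castRingHom ℂ) Int.cast_injective
    change (Mz s.1 * Mz t.1).map (Int.castRingHom ℂ) = (Mz t.1 * Mz s.1).map (Int.castRingHom ℂ)
    rw [Matrix.map_mul, Matrix.map_mul]
    exact hcommC s t
  have hcommO : ∀ s t : τ, MO s * MO t = MO t * MO s := by
    intro s t
    simp only [MO]
    rw [← Matrix.map_mul, ← Matrix.map_mul, hcommZ]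
  -- the transported basis and its flag
  let w : Module.Basis (Fin n) ℂ (J → ℂ) := b.map Φ
  have hw : ∀ i, w i = Φ (b i) := fun i ↦ by simp [w]
  have hflag : ∀ k, w.flag k = (b.flag k).map (Φ : CuspForm (Gamma0 L) κ →ₗ[ℂ] (J → ℂ)) := by
    intro k
    simp only [Module.Basis.flag, ← Submodule.span_image, ← Set.image_comp]
    congr 1
  have hmapO : ∀ t : τ, (MO t).map (algebraMap O ℂ) = (Mz t.1).map (Int.castRingHom ℂ) := by
    intro t
    simp only [MO, Matrix.map_map]
    congr 1
  let θO : Fin n → τ → O := fun i t ↦ ⟨θ i t.1, (hO _).mpr (hθ i t.1 t.2)⟩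
  have htriK : ∀ (t : τ) (i : Fin n),
      ((MO t).map (algebraMap O ℂ)) *ᵥ (w i) - (θO i t : ℂ) • w i ∈ w.flag i.castSucc := by
    intro t i
    haveI : NeZero t.1 := ⟨(hS _ t.2).ne_zero⟩
    rw [hmapO, hw, ← hΦT t.1 (hS _ t.2), hflag]
    refine ⟨heckeT (Gamma0 L) κ t.1 (b i) - θ i t.1 • b i, htri t.1 t.2 i, ?_⟩
    simp [θO, map_sub, map_smul]
  have key := finrank_iInf_maxGenEigenspace_residue_eq_card O MO hcommO w θO htriK χ
  simpa [MO, θO] using key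

end Residual

/-! ### `E_w ≡ 1 (mod p)`: multiplication by `E_w` modulo `𝔪` -/

section Eisenstein

variable {p : ℕ} [Fact p.Prime]

/-- An integer divisible by `p` has norm `< 1` in `ℚ̄_p`. [folklore] -/
theorem norm_intCast_lt_one_of_dvd' {z : ℤ} (hz : (p : ℤ) ∣ z) : ‖(z : PadicAlgCl p)‖ < 1 := by
  rw [← map_intCast (algebraMap ℚ_[p] (PadicAlgCl p)) z]
  change ‖((z : ℚ_[p]) : PadicAlgCl p)‖ < 1
  rw [PadicAlgCl.norm_extends]
  exact Padic.norm_intCast_lt_one_iff.2 hz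

/-- A rational number of `p`-adic valuation `< 1` (an element of `p ℤ_{(p)}`) has norm `< 1` in
`ℚ̄_p`. [folklore] -/
theorem norm_ratCast_lt_one_of_padicValuation_lt_one {r : ℚ} (hr : Rat.padicValuation p r < 1) :
    ‖(r : PadicAlgCl p)‖ < 1 := by
  have hp : p.Prime := Fact.out
  have hnum := (DeligneSerre1974.padicValuation_lt_one_iff_dvd_num r).mp hr
  have hden : ¬ (p : ℤ) ∣ (r.den : ℤ) := by
    intro h
    have h1 : p ∣ r.num.natAbs := Int.natCast_dvd.mp hnum
    have h2 : p ∣ r.num.natAbs.gcd r.den := Nat.dvd_gcd h1 (Int.natCast_dvd_natCast.mp h)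
    rw [r.reduced.gcd_eq_one] at h2
    exact hp.ne_one (Nat.dvd_one.mp h2)
  have hr' : (r : PadicAlgCl p) = (r.num : PadicAlgCl p) / (r.den : ℤ) := by
    rw [Int.cast_natCast]
    exact_mod_cast (Rat.num_div_den r).symm
  rw [hr', norm_div, DeligneSerreLift.norm_intCast_eq_one_of_not_dvd hden, div_one]
  exact norm_intCast_lt_one_of_dvd' hnum

/-- A finite sum of elements of norm `< 1` has norm `< 1` (ultrametric inequality). [folklore] -/
theorem norm_sum_lt_one' {α : Type*} (s : Finset α) (u : α → PadicAlgCl p)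
    (h : ∀ a ∈ s, ‖u a‖ < 1) : ‖∑ a ∈ s, u a‖ < 1 := by
  rcases s.eq_empty_or_nonempty with rfl | hs
  · simp
  · obtain ⟨a, ha, hle⟩ := IsUltrametricDist.exists_norm_finsetSum_le_of_nonempty hs u
    exact hle.trans_lt (h a ha)

/-- A finite sum of elements of norm `≤ 1` has norm `≤ 1` (ultrametric inequality). [folklore] -/
theorem norm_sum_le_one' {α : Type*} (s : Finset α) (u : α → PadicAlgCl p)
    (h : ∀ a ∈ s, ‖u a‖ ≤ 1) : ‖∑ a ∈ s, u a‖ ≤ 1 :=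
  IsUltrametricDist.norm_sum_le_of_forall_le_of_nonneg zero_le_one h

/-- `|a - b| < 1` if `|a|, |b| < 1` (ultrametric inequality). [folklore] -/
theorem norm_sub_lt_one' {a b : PadicAlgCl p} (ha : ‖a‖ < 1) (hb : ‖b‖ < 1) : ‖a - b‖ < 1 := by
  rw [sub_eq_add_neg]
  refine (PadicAlgCl.isNonarchimedean p _ _).trans_lt (max_lt ha ?_)
  rwa [norm_neg]

variable (ι : PadicAlgCl p ≃+* ℂ) {L : ℕ} [NeZero L]

/-- The Hecke operators preserve `p`-integrality of the coefficients of `⟨d⟩`-invariant forms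
(`k ≥ 1`): on `q`-expansions `a_m(T_q x) = a_{qm}(x) + q^{k-1} a_{m/q}(x)`. [folklore] -/
theorem norm_cuspCoeff_heckeT_le_one {k₀ : ℤ} (hk₀ : 1 ≤ k₀) (x : CuspForm (Gamma1 L) k₀)
    (hxd : ∀ d : (ZMod L)ˣ, diamondOp L k₀ (d : ZMod L) x = x)
    (hx : ∀ n, ‖ι.symm (cuspCoeff x n)‖ ≤ 1) (q : ℕ) (hq : q.Prime) (m : ℕ) :
    ‖ι.symm (cuspCoeff ((haveI : NeZero q := ⟨hq.ne_zero⟩; heckeT (Gamma1 L) k₀ q) x) m)‖ ≤ 1 := by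
  haveI : NeZero q := ⟨hq.ne_zero⟩
  rw [cuspCoeff_heckeT_gamma1 x q hq m]
  by_cases hqL : q ∣ L
  · rw [if_pos hqL, add_zero]; exact hx _
  · rw [if_neg hqL]
    obtain ⟨d, hd⟩ := (ZMod.isUnit_prime_iff_not_dvd hq).mpr hqL
    rw [show diamondOp L k₀ (q : ZMod L) x = x by rw [← hd]; exact hxd d]
    obtain ⟨e₀, he₀⟩ : ∃ e₀ : ℕ, k₀ - 1 = (e₀ : ℤ) := ⟨(k₀ - 1).toNat, by omega⟩
    rw [he₀, zpow_natCast, map_add]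
    refine (PadicAlgCl.isNonarchimedean p _ _).trans (max_le (hx _) ?_)
    split_ifs with hqm
    · rw [map_mul, map_pow, map_natCast, norm_mul, norm_pow]
      have hq1 : ‖(q : PadicAlgCl p)‖ ≤ 1 := by
        rw [← Int.cast_natCast]; exact DeligneSerreLift.norm_intCast_le_one _
      exact mul_le_one₀ (pow_le_one₀ (norm_nonneg _) hq1) (norm_nonneg _) (hx _)
    · simp

/-- **`x E_w ≡ x (mod 𝔪)` coefficientwise** for a cusp form `x` with `p`-integral coefficients and
the level-one Eisenstein series `E_w ≡ 1 (mod p)` (`w ≥ 3` even, `(p-1) ∣ w`; von Staudt–Clausen,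
Deligne–Serre 6.9): all coefficients of `x E_w` are `p`-integral and congruent to those of `x`.
[cite: DeligneSerreASENS1974, 6.9] -/
theorem norm_cuspCoeff_mulEisenstein {κ₀ : ℤ} {w : ℕ} (hw3 : 3 ≤ w) (hwe : Even w) (hpw : (p - 1) ∣ w)
    (x : CuspForm (Gamma1 L) κ₀) (hx : ∀ n, ‖ι.symm (cuspCoeff x n)‖ ≤ 1) (m : ℕ) :
    ‖ι.symm (cuspCoeff (x.mulModularForm (ofLevelOne (Gamma1 L) (ModularForm.E hw3))) m) -
        ι.symm (cuspCoeff x m)‖ < 1 ∧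
      ‖ι.symm (cuspCoeff (x.mulModularForm (ofLevelOne (Gamma1 L) (ModularForm.E hw3))) m)‖ ≤ 1 := by
  classical
  set E := ModularForm.E hw3 with hEdef
  obtain ⟨hE0, hEm⟩ := DeligneSerre1974.eisenstein_qExpansion_congr_one (ℓ := p) hw3 hwe hpw
  have hxmul : cuspCoeff (x.mulModularForm (ofLevelOne (Gamma1 L) E)) m =
      ∑ ij ∈ Finset.HasAntidiagonal.antidiagonal m, cuspCoeff x ij.1 * (qExpansion 1 ⇑E).coeff ij.2 := by
    change (qExpansion 1 ⇑(x.mulModularForm (ofLevelOne (Gamma1 L) E))).coeff m = _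
    rw [qExpansion_mulModularForm_ofLevelOne E x, PowerSeries.coeff_mul]
    rfl
  have hEnorm : ∀ j, j ≠ 0 → ‖ι.symm ((qExpansion 1 ⇑E).coeff j)‖ < 1 := by
    intro j hj
    obtain ⟨r, hr, hrj⟩ := hEm j hj
    rw [hrj, map_ratCast]
    exact norm_ratCast_lt_one_of_padicValuation_lt_one hr
  have hlt : ‖ι.symm (cuspCoeff (x.mulModularForm (ofLevelOne (Gamma1 L) E)) m) -
      ι.symm (cuspCoeff x m)‖ < 1 := by
    have hmem : (m, 0) ∈ Finset.HasAntidiagonal.antidiagonal m := by simp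
    rw [hxmul, ← Finset.add_sum_erase _ _ hmem, hE0, mul_one, map_add, add_sub_cancel_left, map_sum]
    refine norm_sum_lt_one' _ _ fun ij hij ↦ ?_
    obtain ⟨hne, hij'⟩ := Finset.mem_erase.mp hij
    have hj : ij.2 ≠ 0 := by
      intro h
      apply hne
      have := Finset.HasAntidiagonal.mem_antidiagonal.mp hij'
      rw [h, add_zero] at this
      exact Prod.ext this h
    rw [map_mul, norm_mul]
    exact mul_lt_one_of_nonneg_of_lt_one_right (hx _) (norm_nonneg _) (hEnorm _ hj)
  refine ⟨hlt, ?_⟩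
  have h1 : ι.symm (cuspCoeff (x.mulModularForm (ofLevelOne (Gamma1 L) E)) m) =
      (ι.symm (cuspCoeff (x.mulModularForm (ofLevelOne (Gamma1 L) E)) m) - ι.symm (cuspCoeff x m)) +
        ι.symm (cuspCoeff x m) := by ring
  rw [h1]
  exact (PadicAlgCl.isNonarchimedean p _ _).trans (max_le hlt.le (hx m))

/-- **`T_q` in weight `k₀ + w` on `x E_w` versus `T_q` in weight `k₀` on `x`, modulo `𝔪`**
(`k₀ ≥ 2`, `w` as above, `q` prime, `x` a `⟨d⟩`-invariant cusp form on `Γ₁(L)` with `p`-integral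
coefficients): `a_m(T_q(x E_w)) ≡ a_m(T_q x) (mod 𝔪)` for all `m` — on `q`-expansions the weight
enters only through `q^{k-1}`, and `q^{k₀+w-1} ≡ q^{k₀-1} (mod p)` (Fermat; Deligne–Serre 6.10).
[cite: DeligneSerreASENS1974, 6.10] -/
theorem norm_cuspCoeff_heckeT_mulEisenstein_sub {k₀ : ℤ} (hk₀ : 2 ≤ k₀) {w : ℕ} (hw3 : 3 ≤ w)
    (hwe : Even w) (hpw : (p - 1) ∣ w) (x : CuspForm (Gamma1 L) k₀)
    (hxd : ∀ d : (ZMod L)ˣ, diamondOp L k₀ (d : ZMod L) x = x)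
    (hx : ∀ n, ‖ι.symm (cuspCoeff x n)‖ ≤ 1) (q : ℕ) (hq : q.Prime) (m : ℕ) :
    ‖ι.symm (cuspCoeff ((haveI : NeZero q := ⟨hq.ne_zero⟩; heckeT (Gamma1 L) (k₀ + w) q)
        (x.mulModularForm (ofLevelOne (Gamma1 L) (ModularForm.E hw3)))) m) -
      ι.symm (cuspCoeff ((haveI : NeZero q := ⟨hq.ne_zero⟩; heckeT (Gamma1 L) k₀ q) x) m)‖ < 1 := by
  classical
  have hp : p.Prime := Fact.out
  haveI : NeZero q := ⟨hq.ne_zero⟩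
  set y := x.mulModularForm (ofLevelOne (Gamma1 L) (ModularForm.E hw3)) with hydef
  have hyx : ∀ n, ‖ι.symm (cuspCoeff y n) - ι.symm (cuspCoeff x n)‖ < 1 ∧ ‖ι.symm (cuspCoeff y n)‖ ≤ 1 :=
    fun n ↦ norm_cuspCoeff_mulEisenstein ι hw3 hwe hpw x hx n
  -- diamond invariance of `y`
  have hyd : ∀ d : (ZMod L)ˣ, diamondOp L (k₀ + w) (d : ZMod L) y = y := fun d ↦ by
    rw [hydef, diamondOp_mulModularForm_ofLevelOne (ModularForm.E hw3) (d : ZMod L) x, hxd d]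
  -- exponents
  obtain ⟨e₀, he₀⟩ : ∃ e₀ : ℕ, k₀ - 1 = (e₀ : ℤ) := ⟨(k₀ - 1).toNat, by omega⟩
  have hzpow₀ : (q : ℂ) ^ (k₀ - 1) = ((q ^ e₀ : ℕ) : ℂ) := by rw [he₀, zpow_natCast, Nat.cast_pow]
  have hzpow : (q : ℂ) ^ (k₀ + (w : ℤ) - 1) = ((q ^ (e₀ + w) : ℕ) : ℂ) := by
    rw [show k₀ + (w : ℤ) - 1 = ((e₀ + w : ℕ) : ℤ) by push_cast; omega, zpow_natCast, Nat.cast_pow]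
  have hdvd : (p : ℤ) ∣ ((q ^ (e₀ + w) : ℕ) : ℤ) - ((q ^ e₀ : ℕ) : ℤ) := by
    have hfac : ((q ^ (e₀ + w) : ℕ) : ℤ) - ((q ^ e₀ : ℕ) : ℤ) = (q : ℤ) ^ e₀ * ((q : ℤ) ^ w - 1) := by
      push_cast; ring
    rw [hfac]
    by_cases hqp : q = p
    · subst hqp
      have he₀1 : 1 ≤ e₀ := by omega
      exact Dvd.dvd.mul_right (dvd_pow_self (q : ℤ) (by omega)) _
    · apply Dvd.dvd.mul_left
      have hcop : IsCoprime (q : ℤ) p := by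
        rw [Nat.isCoprime_iff_coprime]
        exact (Nat.coprime_primes hq hp).2 hqp
      obtain ⟨c, hc⟩ := hpw
      have h1 : (q : ℤ) ^ (p - 1) ≡ 1 [ZMOD p] := Int.ModEq.pow_card_sub_one_eq_one hp hcop
      have h2 : (q : ℤ) ^ w ≡ 1 [ZMOD p] := by
        rw [hc, pow_mul]
        simpa using h1.pow c
      exact Int.ModEq.dvd h2.symm
  have hpowdiff : ‖ι.symm (((q ^ (e₀ + w) : ℕ) : ℂ)) - ι.symm (((q ^ e₀ : ℕ) : ℂ))‖ < 1 := by
    rw [map_natCast, map_natCast]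
    have h := norm_intCast_lt_one_of_dvd' hdvd
    push_cast at h ⊢
    exact h
  have hpownorm : ‖ι.symm (((q ^ (e₀ + w) : ℕ) : ℂ))‖ ≤ 1 := by
    rw [map_natCast, ← Int.cast_natCast]
    exact DeligneSerreLift.norm_intCast_le_one _
  -- the two `q`-expansions
  have hTy := cuspCoeff_heckeT_gamma1 y q hq m
  have hTx := cuspCoeff_heckeT_gamma1 x q hq m
  set D : ℕ → PadicAlgCl p := fun n ↦ ι.symm (cuspCoeff y n) - ι.symm (cuspCoeff x n) with hD
  have hDlt : ∀ n, ‖D n‖ < 1 := fun n ↦ (hyx n).1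
  have hyD : ∀ n, ι.symm (cuspCoeff y n) = ι.symm (cuspCoeff x n) + D n := fun n ↦ by rw [hD]; ring
  by_cases hqL : q ∣ L
  · rw [if_pos hqL, add_zero] at hTy hTx
    rw [hTy, hTx, hyD]
    simpa using hDlt (q * m)
  · rw [if_neg hqL] at hTy hTx
    obtain ⟨d, hd⟩ := (ZMod.isUnit_prime_iff_not_dvd hq).mpr hqL
    have hdiagy : diamondOp L (k₀ + w) (q : ZMod L) y = y := by rw [← hd]; exact hyd d
    have hdiagx : diamondOp L k₀ (q : ZMod L) x = x := by rw [← hd]; exact hxd d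
    rw [hdiagy, hzpow] at hTy
    rw [hdiagx, hzpow₀] at hTx
    by_cases hqm : q ∣ m
    · rw [if_pos hqm] at hTy hTx
      have e1 : ι.symm (cuspCoeff (heckeT (Gamma1 L) (k₀ + ↑w) q y) m) -
          ι.symm (cuspCoeff (heckeT (Gamma1 L) k₀ q x) m) =
          D (q * m) + (ι.symm (((q ^ (e₀ + w) : ℕ) : ℂ)) * D (m / q) +
            (ι.symm (((q ^ (e₀ + w) : ℕ) : ℂ)) - ι.symm (((q ^ e₀ : ℕ) : ℂ))) *
              ι.symm (cuspCoeff x (m / q))) := by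
        rw [hTy, hTx, map_add, map_add, map_mul, map_mul, hyD, hyD (m / q)]
        ring
      rw [e1]
      refine (PadicAlgCl.isNonarchimedean p _ _).trans_lt (max_lt (hDlt _) ?_)
      refine (PadicAlgCl.isNonarchimedean p _ _).trans_lt (max_lt ?_ ?_)
      · rw [norm_mul]
        exact mul_lt_one_of_nonneg_of_lt_one_right hpownorm (norm_nonneg _) (hDlt _)
      · rw [norm_mul]
        exact mul_lt_one_of_nonneg_of_lt_one_left (norm_nonneg _) hpowdiff (hx _)
    · rw [if_neg hqm, mul_zero, add_zero] at hTy hTx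
      rw [hTy, hTx, hyD]
      simpa using hDlt (q * m)

end Eisenstein

/-! ### Multiplication by `E_w` raises residual multiplicities -/

section EisensteinMap

variable {p : ℕ} [Fact p.Prime]

set_option maxHeartbeats 1600000 in
/-- **Residual multiplicities grow from weight `2` to weight `2 + w`** (`w ≥ 3` even,
`(p - 1) ∣ w`).  For bases of `S_2(Γ₀(L))` and `S_{2+w}(Γ₀(L))` triangularising the Hecke
operators `T_q`, `q ∈ S`, with `p`-integral diagonal characters, every residual character `χ̄` of
`S` is the reduction of at most as many diagonal characters in weight `2` as in weight `2 + w`.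
Proof: both numbers are the dimensions of the simultaneous generalised `χ̄`-eigenspaces of the
reduced integral Hecke matrices (`finrank_residual_eq_card`), and multiplication by
`E_w ≡ 1 (mod p)` induces, in integral coordinates, an INJECTIVE map modulo `𝔪` intertwining the
reduced Hecke matrices of the two weights (Deligne–Serre 6.9–6.11: `a_n(T_q(f E_w)) ≡ a_n(T_q f)`).
[cite: DeligneSerreASENS1974, 6.9–6.11] -/
theorem card_residual_le_of_eisenstein (ι : PadicAlgCl p ≃+* ℂ) {O : ValuationSubring ℂ}
    (hO : ∀ x, x ∈ O ↔ ‖ι.symm x‖ ≤ 1) {L : ℕ} [NeZero L] {w : ℕ} (hw3 : 3 ≤ w) (hwe : Even w)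
    (hpw : (p - 1) ∣ w) (S : ℕ → Prop) (hS : ∀ q, S q → q.Prime)
    {n₂ : ℕ} (b₂ : Module.Basis (Fin n₂) ℂ (CuspForm (Gamma0 L) 2)) (θ₂ : Fin n₂ → ℕ → ℂ)
    (hθ₂ : ∀ i q, S q → ‖ι.symm (θ₂ i q)‖ ≤ 1)
    (htri₂ : ∀ (q : ℕ) (hq : S q) (i : Fin n₂),
      (haveI : NeZero q := ⟨(hS q hq).ne_zero⟩; heckeT (Gamma0 L) 2 q (b₂ i)) - θ₂ i q • b₂ i ∈
        b₂.flag i.castSucc)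
    {n : ℕ} (b : Module.Basis (Fin n) ℂ (CuspForm (Gamma0 L) (2 + w))) (θ : Fin n → ℕ → ℂ)
    (hθ : ∀ i q, S q → ‖ι.symm (θ i q)‖ ≤ 1)
    (htri : ∀ (q : ℕ) (hq : S q) (i : Fin n),
      (haveI : NeZero q := ⟨(hS q hq).ne_zero⟩; heckeT (Gamma0 L) (2 + w) q (b i)) - θ i q • b i ∈
        b.flag i.castSucc)
    (χ : {q : ℕ // S q} → ResidueField O) [DecidableEq ({q : ℕ // S q} → ResidueField O)] :
    (Finset.univ.filter fun i : Fin n₂ ↦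
        (fun t : {q : ℕ // S q} ↦ residue O ⟨θ₂ i t.1, (hO _).mpr (hθ₂ i t.1 t.2)⟩) = χ).card ≤
      (Finset.univ.filter fun i : Fin n ↦
        (fun t : {q : ℕ // S q} ↦ residue O ⟨θ i t.1, (hO _).mpr (hθ i t.1 t.2)⟩) = χ).card := by
  classical
  obtain ⟨J₂, _, _, Φ₂, crd₂, bv₂, Mz₂, hΦ₂, hΦbv₂, hint₂, hT₂, hle₂, hlt₂, hrec₂⟩ :=
    exists_coordinates ι L 2 (by norm_num)
  obtain ⟨J, _, _, Φ, crd, bv, Mz, hΦ, hΦbv, hint, hT, hle, hlt, hrec⟩ :=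
    exists_coordinates ι L (2 + (w : ℤ)) (by omega)
  -- Hecke matrices on `Γ₀(L)`-forms
  have hΦT₂ : ∀ (q : ℕ) (hq : q.Prime) (f : CuspForm (Gamma0 L) 2),
      Φ₂ ((haveI : NeZero q := ⟨hq.ne_zero⟩; heckeT (Gamma0 L) 2 q) f) =
        ((Mz₂ q).map (Int.castRingHom ℂ)) *ᵥ Φ₂ f := by
    intro q hq f
    haveI : NeZero q := ⟨hq.ne_zero⟩
    rw [hΦ₂, hΦ₂, ← heckeT_liftToGamma1, hT₂ q hq _ (fun d ↦ diamondOp_liftToGamma1 L 2 _ f)]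
  have hΦT : ∀ (q : ℕ) (hq : q.Prime) (f : CuspForm (Gamma0 L) (2 + w)),
      Φ ((haveI : NeZero q := ⟨hq.ne_zero⟩; heckeT (Gamma0 L) (2 + w) q) f) =
        ((Mz q).map (Int.castRingHom ℂ)) *ᵥ Φ f := by
    intro q hq f
    haveI : NeZero q := ⟨hq.ne_zero⟩
    rw [hΦ, hΦ, ← heckeT_liftToGamma1, hT q hq _ (fun d ↦ diamondOp_liftToGamma1 L (2 + w) _ f)]
  rw [← finrank_residual_eq_card ι hO Φ₂ Mz₂ hΦT₂ S hS b₂ θ₂ hθ₂ htri₂ χ,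
    ← finrank_residual_eq_card ι hO Φ Mz hΦT S hS b θ hθ htri χ]
  -- ### lifts: diamond invariance, compatibility with `· E_w`, integrality
  have hxE : ∀ f : CuspForm (Gamma0 L) 2,
      (liftToGamma1 L 2 f).mulModularForm (ofLevelOne (Gamma1 L) (ModularForm.E hw3)) =
        liftToGamma1 L (2 + w) (f.mulModularForm (ofLevelOne (Gamma0 L) (ModularForm.E hw3))) := by
    intro f
    apply DFunLike.coe_injective
    rw [CuspForm.coe_mulModularForm, coe_liftToGamma1_holds L 2 f,
      coe_liftToGamma1_holds L (2 + (w : ℤ)), CuspForm.coe_mulModularForm]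
    rfl
  have hdiam₂ : ∀ (f : CuspForm (Gamma0 L) 2) (d : (ZMod L)ˣ),
      diamondOp L 2 (d : ZMod L) (liftToGamma1 L 2 f) = liftToGamma1 L 2 f :=
    fun f d ↦ diamondOp_liftToGamma1 L 2 _ f
  have hdiam : ∀ (f : CuspForm (Gamma0 L) (2 + w)) (d : (ZMod L)ˣ),
      diamondOp L (2 + w) (d : ZMod L) (liftToGamma1 L (2 + w) f) = liftToGamma1 L (2 + w) f :=
    fun f d ↦ diamondOp_liftToGamma1 L (2 + w) _ f
  have hnorm_int : ∀ z : ℤ, ‖ι.symm (z : ℂ)‖ ≤ 1 := fun z ↦ by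
    rw [map_intCast]; exact DeligneSerreLift.norm_intCast_le_one _
  have hxint : ∀ j m, ‖ι.symm (cuspCoeff (liftToGamma1 L 2 (bv₂ j)) m)‖ ≤ 1 := by
    intro j m
    obtain ⟨z, hz⟩ := hint₂ j m
    have h : cuspCoeff (liftToGamma1 L 2 (bv₂ j)) m = z := by
      rw [← hz]
      change (qExpansion 1 ⇑(liftToGamma1 L 2 (bv₂ j))).coeff m = _
      rw [coe_liftToGamma1_holds L 2 (bv₂ j)]
    rw [h]; exact hnorm_int z
  have hbvint : ∀ i m, ‖ι.symm (cuspCoeff (liftToGamma1 L (2 + w) (bv i)) m)‖ ≤ 1 := by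
    intro i m
    obtain ⟨z, hz⟩ := hint i m
    have h : cuspCoeff (liftToGamma1 L (2 + w) (bv i)) m = z := by
      rw [← hz]
      change (qExpansion 1 ⇑(liftToGamma1 L (2 + w) (bv i))).coeff m = _
      rw [coe_liftToGamma1_holds L (2 + (w : ℤ)) (bv i)]
    rw [h]; exact hnorm_int z
  -- ### `y j = x_j E_w`
  obtain ⟨y, hy⟩ : ∃ y : J₂ → CuspForm (Gamma1 L) (2 + w), ∀ j,
      y j = (liftToGamma1 L 2 (bv₂ j)).mulModularForm (ofLevelOne (Gamma1 L) (ModularForm.E hw3)) :=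
    ⟨_, fun j ↦ rfl⟩
  have hyd : ∀ j (d : (ZMod L)ˣ), diamondOp L (2 + w) (d : ZMod L) (y j) = y j := fun j d ↦ by
    rw [hy, hxE, hdiam]
  have hyint : ∀ j m, ‖ι.symm (cuspCoeff (y j) m)‖ ≤ 1 := fun j m ↦ by
    rw [hy]; exact (norm_cuspCoeff_mulEisenstein ι hw3 hwe hpw _ (hxint j) m).2
  -- ### the matrix `R` of `· E_w` in the integral coordinates
  obtain ⟨R, hR⟩ : ∃ R : Matrix J J₂ O, ∀ i j, ((R i j : O) : ℂ) = crd (y j) i :=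
    ⟨Matrix.of fun i j ↦ ⟨crd (y j) i, (hO _).mpr (hle (y j) 1 zero_le_one (hyd j) (hyint j) i)⟩,
      fun i j ↦ rfl⟩
  -- ### `R` intertwines the reduced Hecke matrices
  have hinter : ∀ t : {q : ℕ // S q},
      ((Mz t.1).map (Int.castRingHom O)).map (residue O) * R.map (residue O) =
        R.map (residue O) * ((Mz₂ t.1).map (Int.castRingHom O)).map (residue O) := by
    intro t
    have hq : t.1.Prime := hS _ t.2
    haveI : NeZero t.1 := ⟨hq.ne_zero⟩
    rw [← Matrix.map_mul, ← Matrix.map_mul]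
    ext i j
    rw [Matrix.map_apply, Matrix.map_apply, residue_eq_iff_norm ι hO]
    have e1 : ((((Mz t.1).map (Int.castRingHom O)) * R) i j : ℂ) =
        crd (heckeT (Gamma1 L) (2 + w) t.1 (y j)) i := by
      rw [hT t.1 hq _ (hyd j)]
      simp only [Matrix.mul_apply, Matrix.mulVec, dotProduct, Matrix.map_apply, eq_intCast,
        AddSubmonoidClass.coe_finsetSum, MulMemClass.coe_mul, SubringClass.coe_intCast, hR]
    have hcol : heckeT (Gamma1 L) 2 t.1 (liftToGamma1 L 2 (bv₂ j)) =
        ∑ l, ((Mz₂ t.1 l j : ℤ) : ℂ) • liftToGamma1 L 2 (bv₂ l) := by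
      have hTd : ∀ d : (ZMod L)ˣ, diamondOp L 2 (d : ZMod L)
          (heckeT (Gamma1 L) 2 t.1 (liftToGamma1 L 2 (bv₂ j))) =
            heckeT (Gamma1 L) 2 t.1 (liftToGamma1 L 2 (bv₂ j)) := by
        intro d; rw [heckeT_liftToGamma1, hdiam₂]
      conv_lhs => rw [hrec₂ _ hTd]
      refine Finset.sum_congr rfl fun l _ ↦ ?_
      congr 1
      rw [hT₂ t.1 hq _ (hdiam₂ (bv₂ j)), ← hΦ₂, hΦbv₂]
      simp only [Matrix.mulVec, dotProduct, Matrix.map_apply, eq_intCast, Pi.single_apply, mul_ite,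
        mul_one, mul_zero, Finset.sum_ite_eq', Finset.mem_univ, if_true]
    have e2 : ((R * (Mz₂ t.1).map (Int.castRingHom O)) i j : ℂ) =
        crd ((heckeT (Gamma1 L) 2 t.1 (liftToGamma1 L 2 (bv₂ j))).mulModularForm
          (ofLevelOne (Gamma1 L) (ModularForm.E hw3))) i := by
      rw [hcol, sum_smul_mulModularForm, map_sum, Finset.sum_apply, Matrix.mul_apply,
        AddSubmonoidClass.coe_finsetSum]
      refine Finset.sum_congr rfl fun l _ ↦ ?_
      rw [← hy l, map_smul, Pi.smul_apply, smul_eq_mul, MulMemClass.coe_mul, hR, Matrix.map_apply,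
        eq_intCast, SubringClass.coe_intCast, mul_comm]
    rw [e1, e2, ← map_sub, ← Pi.sub_apply, ← map_sub]
    refine hlt _ 1 (fun d ↦ ?_) (fun m ↦ ?_) i
    · rw [map_sub, hy, hxE, heckeT_liftToGamma1, hdiam, heckeT_liftToGamma1, hxE, hdiam]
    · rw [cuspCoeff_sub_gamma1, map_sub]
      have h1 := norm_cuspCoeff_heckeT_mulEisenstein_sub ι (le_refl (2 : ℤ)) hw3 hwe hpw
        (liftToGamma1 L 2 (bv₂ j)) (hdiam₂ (bv₂ j)) (hxint j) t.1 hq m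
      have hTxint : ∀ m, ‖ι.symm (cuspCoeff (heckeT (Gamma1 L) 2 t.1
          (liftToGamma1 L 2 (bv₂ j))) m)‖ ≤ 1 := fun m ↦
        norm_cuspCoeff_heckeT_le_one ι (by norm_num) _ (hdiam₂ (bv₂ j)) (hxint j) t.1 hq m
      have h2 := (norm_cuspCoeff_mulEisenstein ι hw3 hwe hpw _ hTxint m).1
      have e : ι.symm (cuspCoeff (heckeT (Gamma1 L) (2 + w) t.1 (y j)) m) -
          ι.symm (cuspCoeff ((heckeT (Gamma1 L) 2 t.1 (liftToGamma1 L 2 (bv₂ j))).mulModularForm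
            (ofLevelOne (Gamma1 L) (ModularForm.E hw3))) m) =
          (ι.symm (cuspCoeff (heckeT (Gamma1 L) (2 + w) t.1 (y j)) m) -
            ι.symm (cuspCoeff (heckeT (Gamma1 L) 2 t.1 (liftToGamma1 L 2 (bv₂ j))) m)) -
          (ι.symm (cuspCoeff ((heckeT (Gamma1 L) 2 t.1 (liftToGamma1 L 2 (bv₂ j))).mulModularForm
            (ofLevelOne (Gamma1 L) (ModularForm.E hw3))) m) -
            ι.symm (cuspCoeff (heckeT (Gamma1 L) 2 t.1 (liftToGamma1 L 2 (bv₂ j))) m)) := by ring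
      rw [e]
      refine norm_sub_lt_one' ?_ h2
      rw [hy j]
      exact h1
  -- ### `R mod 𝔪` is injective
  have hinj : Function.Injective (Matrix.toLin' (R.map (residue O))) := by
    rw [← LinearMap.ker_eq_bot, LinearMap.ker_eq_bot']
    intro v hv
    rw [Matrix.toLin'_apply] at hv
    obtain ⟨c, hc⟩ : ∃ c : J₂ → O, ∀ j, residue O (c j) = v j :=
      ⟨fun j ↦ Classical.choose (IsLocalRing.residue_surjective (v j)),
        fun j ↦ Classical.choose_spec (IsLocalRing.residue_surjective (v j))⟩
    -- `x := ∑ c_j x_j`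
    obtain ⟨g, hg⟩ : ∃ g : CuspForm (Gamma0 L) 2, g = ∑ j, ((c j : O) : ℂ) • bv₂ j := ⟨_, rfl⟩
    have hxsum : liftToGamma1 L 2 g = ∑ j, ((c j : O) : ℂ) • liftToGamma1 L 2 (bv₂ j) := by
      rw [hg, map_sum]
      simp only [map_smul]
    have hxint' : ∀ m, ‖ι.symm (cuspCoeff (liftToGamma1 L 2 g) m)‖ ≤ 1 := by
      intro m
      rw [hxsum, LevelDescent.cuspCoeff_sum_smul_gamma1, map_sum]
      refine norm_sum_le_one' _ _ fun j _ ↦ ?_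
      rw [map_mul, norm_mul]
      exact mul_le_one₀ ((hO _).mp (c j).2) (norm_nonneg _) (hxint j m)
    -- `x E_w = ∑ c_j y_j` has coordinates `R c ∈ 𝔪`, hence small coefficients
    have hxE' : (liftToGamma1 L 2 g).mulModularForm (ofLevelOne (Gamma1 L) (ModularForm.E hw3)) =
        ∑ j, ((c j : O) : ℂ) • y j := by
      rw [hxsum, sum_smul_mulModularForm]
      exact Finset.sum_congr rfl fun j _ ↦ by rw [hy j]
    have hxEd : ∀ d : (ZMod L)ˣ, diamondOp L (2 + w) (d : ZMod L)
        ((liftToGamma1 L 2 g).mulModularForm (ofLevelOne (Gamma1 L) (ModularForm.E hw3))) =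
          (liftToGamma1 L 2 g).mulModularForm (ofLevelOne (Gamma1 L) (ModularForm.E hw3)) := by
      intro d; rw [hxE, hdiam]
    have hcrdE : ∀ i, ‖ι.symm (crd ((liftToGamma1 L 2 g).mulModularForm
        (ofLevelOne (Gamma1 L) (ModularForm.E hw3))) i)‖ < 1 := by
      intro i
      have hci : crd ((liftToGamma1 L 2 g).mulModularForm
          (ofLevelOne (Gamma1 L) (ModularForm.E hw3))) i = ((R *ᵥ c) i : O) := by
        rw [hxE', map_sum, Finset.sum_apply, Matrix.mulVec, dotProduct,
          AddSubmonoidClass.coe_finsetSum]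
        refine Finset.sum_congr rfl fun j _ ↦ ?_
        rw [map_smul, Pi.smul_apply, smul_eq_mul, MulMemClass.coe_mul, hR, mul_comm]
      rw [hci, ← mem_maximalIdeal_iff_norm ι hO, ← residue_eq_zero_iff, RingHom.map_mulVec,
        show (residue O : O → ResidueField O) ∘ c = v from funext hc]
      exact congrFun hv i
    have hcoefE : ∀ m, ‖ι.symm (cuspCoeff ((liftToGamma1 L 2 g).mulModularForm
        (ofLevelOne (Gamma1 L) (ModularForm.E hw3))) m)‖ < 1 := by
      intro m
      rw [hrec _ hxEd, LevelDescent.cuspCoeff_sum_smul_gamma1, map_sum]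
      refine norm_sum_lt_one' _ _ fun i _ ↦ ?_
      rw [map_mul, norm_mul]
      exact mul_lt_one_of_nonneg_of_lt_one_left (norm_nonneg _) (hcrdE i) (hbvint i m)
    -- hence `x` has small coefficients, and its coordinates `c` lie in `𝔪`
    have hcoef : ∀ m, ‖ι.symm (cuspCoeff (liftToGamma1 L 2 g) m)‖ < 1 := by
      intro m
      have h1 := (norm_cuspCoeff_mulEisenstein ι hw3 hwe hpw (liftToGamma1 L 2 g) hxint' m).1
      have e : ι.symm (cuspCoeff (liftToGamma1 L 2 g) m) =
          ι.symm (cuspCoeff ((liftToGamma1 L 2 g).mulModularForm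
            (ofLevelOne (Gamma1 L) (ModularForm.E hw3))) m) -
          (ι.symm (cuspCoeff ((liftToGamma1 L 2 g).mulModularForm
            (ofLevelOne (Gamma1 L) (ModularForm.E hw3))) m) -
            ι.symm (cuspCoeff (liftToGamma1 L 2 g) m)) := by ring
      rw [e]
      exact norm_sub_lt_one' (hcoefE m) h1
    funext j
    rw [Pi.zero_apply, ← hc j, residue_eq_zero_iff, mem_maximalIdeal_iff_norm ι hO]
    have hcj : ((c j : O) : ℂ) = crd₂ (liftToGamma1 L 2 g) j := by
      rw [← hΦ₂, hg, map_sum, Finset.sum_apply]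
      simp only [map_smul, hΦbv₂, Pi.smul_apply, Pi.single_apply, smul_eq_mul, mul_ite, mul_one,
        mul_zero, Finset.sum_ite_eq, Finset.mem_univ, if_true]
    rw [hcj]
    exact hlt₂ _ 1 (hdiam₂ g) hcoef j
  -- ### conclusion
  haveI : FiniteDimensional (ResidueField O) (J → ResidueField O) := Module.Finite.pi
  have key := finrank_iInf_maxGenEigenspace_le_of_injective (Matrix.toLin' (R.map (residue O))) hinj
    (fun t ↦ Matrix.toLin' (((Mz₂ t.1).map (Int.castRingHom O)).map (residue O)))
    (fun t ↦ Matrix.toLin' (((Mz t.1).map (Int.castRingHom O)).map (residue O))) (fun t v ↦ by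
      rw [Matrix.toLin'_apply, Matrix.toLin'_apply, Matrix.toLin'_apply, Matrix.toLin'_apply,
        Matrix.mulVec_mulVec, Matrix.mulVec_mulVec, hinter t]) χ
  exact key

end EisensteinMap

/-! ### Counting characters: termwise equality from a sum equality -/

/-- **Count transfer.**  Two families of "characters" `ψ₂`, `ψ` with values in `X` such that every
value is taken at most as often by `ψ₂` as by `ψ` (`hle`), while the values satisfying `u` are
taken (with multiplicity) at least as often by `ψ₂` as by `ψ` (`hu`), take every value satisfying
`u` equally often; hence `#{i | P (ψ₂ i)} = #{i | P (ψ i)}` for every `P ⊆ u`. [folklore] -/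
theorem card_filter_comp_eq_of_forall_le {X : Type*} [DecidableEq X] {n₂ n : ℕ} (ψ₂ : Fin n₂ → X)
    (ψ : Fin n → X) (u : X → Prop) [DecidablePred u]
    (hle : ∀ χ, (Finset.univ.filter fun i ↦ ψ₂ i = χ).card ≤
      (Finset.univ.filter fun i ↦ ψ i = χ).card)
    (hu : (Finset.univ.filter fun i ↦ u (ψ i)).card ≤ (Finset.univ.filter fun i ↦ u (ψ₂ i)).card)
    (P : X → Prop) [DecidablePred P] (hP : ∀ χ, P χ → u χ) :
    (Finset.univ.filter fun i ↦ P (ψ₂ i)).card = (Finset.univ.filter fun i ↦ P (ψ i)).card := by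
  classical
  -- fibrewise counting over a finite set of values containing all values taken
  set T : Finset X := Finset.univ.image ψ₂ ∪ Finset.univ.image ψ with hT
  have hfib : ∀ {m : ℕ} (φ : Fin m → X) (_ : ∀ i, φ i ∈ T) (Q : X → Prop) [DecidablePred Q],
      (Finset.univ.filter fun i ↦ Q (φ i)).card =
        ∑ χ ∈ T.filter Q, (Finset.univ.filter fun i ↦ φ i = χ).card := by
    intro m φ hφ Q _
    rw [Finset.card_eq_sum_card_fiberwise (f := φ) (t := T.filter Q) (fun i hi ↦ ?_)]
    · refine Finset.sum_congr rfl fun χ hχ ↦ ?_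
      rw [Finset.filter_filter]
      refine congrArg Finset.card (Finset.filter_congr fun i _ ↦ ?_)
      simp only [and_iff_right_iff_imp]
      intro h
      rw [h]
      exact (Finset.mem_filter.mp hχ).2
    · have hi' : Q (φ i) := by simpa using hi
      exact Finset.mem_coe.mpr (Finset.mem_filter.mpr ⟨hφ i, hi'⟩)
  have hψ₂T : ∀ i, ψ₂ i ∈ T := fun i ↦
    Finset.mem_union_left _ (Finset.mem_image_of_mem _ (Finset.mem_univ _))
  have hψT : ∀ i, ψ i ∈ T := fun i ↦
    Finset.mem_union_right _ (Finset.mem_image_of_mem _ (Finset.mem_univ _))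
  -- equality on the values satisfying `u`
  have hequ : ∀ χ ∈ T.filter u, (Finset.univ.filter fun i ↦ ψ₂ i = χ).card =
      (Finset.univ.filter fun i ↦ ψ i = χ).card := by
    have hsum : ∑ χ ∈ T.filter u, (Finset.univ.filter fun i ↦ ψ i = χ).card ≤
        ∑ χ ∈ T.filter u, (Finset.univ.filter fun i ↦ ψ₂ i = χ).card := by
      rw [← hfib ψ hψT u, ← hfib ψ₂ hψ₂T u]; exact hu
    exact (Finset.sum_eq_sum_iff_of_le fun χ _ ↦ hle χ).mp
      (le_antisymm (Finset.sum_le_sum fun χ _ ↦ hle χ) hsum)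
  -- conclusion
  rw [hfib ψ₂ hψ₂T P, hfib ψ hψT P]
  refine Finset.sum_congr rfl fun χ hχ ↦ hequ χ ?_
  exact Finset.mem_filter.mpr ⟨(Finset.mem_filter.mp hχ).1, hP χ (Finset.mem_filter.mp hχ).2⟩

/-! ### Rank constancy ⇒ equality of the weighted newform counts -/

section Count

variable {p : ℕ} [Fact p.Prime]

set_option maxHeartbeats 1600000 in
/-- **Rank constancy in weights `2` and `2 + w` at level `N' p` forces equal weighted counts of
congruent `p`-ordinary newforms.**  Fix `ι : ℚ̄_p ≃ ℂ`, `p ∤ N'`, `N' p ∣ A`, a target system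
`c : primes → 𝒪_{ℚ̄_p}`, and `w ≥ 3` even with `(p-1) ∣ w`.  Write `r_κ(M)` (resp. `s_κ(M)`) for
the number of newforms of weight `κ` and level `M` (resp. `M p`) congruent to `c` at the primes
`q ∤ A` and with `|ι⁻¹ a_p| = 1`.  If the number of `p`-adic unit eigenvalues of `U_p` on
`S_κ(Γ₀(N' p))` (with multiplicity) is the same for `κ = 2 + w` and `κ = 2`, then
`∑_{M ∣ N'} σ₀(N'/M) (r_{2+w}(M) + s_{2+w}(M)) = ∑_{M ∣ N'} σ₀(N'/M) (r_2(M) + s_2(M))`.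
Proof: both sides count the diagonal characters of the `U_p`-triangular Atkin–Lehner bases
(`exists_triangular_basis`) whose residual eigensystem is `c̄` off `A` and non-zero at `U_p`; by
`card_residual_le_of_eisenstein` every residual system occurs at most as often in weight `2` as in
weight `2 + w`, and by the hypothesis the unit-`U_p` ones occur equally often in total, hence each
equally often (`card_filter_comp_eq_of_forall_le`). [cite: Hida2022EMI, Lemma 4.1.25] -/
theorem sum_divisors_count_eq_of_rank_eq (ι : PadicAlgCl p ≃+* ℂ) {N' : ℕ} [NeZero N']
    (hpN' : ¬ p ∣ N') {A : ℕ} (hA : N' * p ∣ A) {w : ℕ} (hw3 : 3 ≤ w) (hwe : Even w)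
    (hpw : (p - 1) ∣ w) (c : ℕ → PadicAlgCl p) (hc : ∀ q, q.Prime → ‖c q‖ ≤ 1)
    (hRC : (haveI : NeZero p := ⟨(Fact.out : p.Prime).ne_zero⟩;
      finrank ℂ ↥(⨆ (u : ℂ) (_ : ‖ι.symm u‖ = 1),
          (heckeT (Gamma0 (N' * p)) (2 + w) p).maxGenEigenspace u) =
        finrank ℂ ↥(⨆ (u : ℂ) (_ : ‖ι.symm u‖ = 1),
          (heckeT (Gamma0 (N' * p)) 2 p).maxGenEigenspace u)))
    (r₂ s₂ r s : ℕ → ℕ)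
    (hr₂ : ∀ (M : ℕ) [NeZero M], M ∣ N' → r₂ M = {f : CuspForm (Gamma0 M) 2 | IsNewform0 f ∧
      (∀ q : ℕ, q.Prime → ¬ q ∣ A → ‖ι.symm ((qExpansion 1 ⇑f).coeff q) - c q‖ < 1) ∧
      ‖ι.symm ((qExpansion 1 ⇑f).coeff p)‖ = 1}.ncard)
    (hs₂ : ∀ (M : ℕ) [NeZero M], M ∣ N' → s₂ M = {f : CuspForm (Gamma0 (M * p)) 2 | IsNewform0 f ∧
      (∀ q : ℕ, q.Prime → ¬ q ∣ A → ‖ι.symm ((qExpansion 1 ⇑f).coeff q) - c q‖ < 1) ∧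
      ‖ι.symm ((qExpansion 1 ⇑f).coeff p)‖ = 1}.ncard)
    (hr : ∀ (M : ℕ) [NeZero M], M ∣ N' → r M = {f : CuspForm (Gamma0 M) (2 + w) | IsNewform0 f ∧
      (∀ q : ℕ, q.Prime → ¬ q ∣ A → ‖ι.symm ((qExpansion 1 ⇑f).coeff q) - c q‖ < 1) ∧
      ‖ι.symm ((qExpansion 1 ⇑f).coeff p)‖ = 1}.ncard)
    (hs : ∀ (M : ℕ) [NeZero M], M ∣ N' → s M = {f : CuspForm (Gamma0 (M * p)) (2 + w) |
      IsNewform0 f ∧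
      (∀ q : ℕ, q.Prime → ¬ q ∣ A → ‖ι.symm ((qExpansion 1 ⇑f).coeff q) - c q‖ < 1) ∧
      ‖ι.symm ((qExpansion 1 ⇑f).coeff p)‖ = 1}.ncard) :
    ∑ M ∈ N'.divisors, (N' / M).divisors.card * (r M + s M) =
      ∑ M ∈ N'.divisors, (N' / M).divisors.card * (r₂ M + s₂ M) := by
  classical
  have hp : p.Prime := Fact.out
  haveI : NeZero p := ⟨hp.ne_zero⟩
  haveI : FiniteDimensional ℂ (CuspForm (Gamma0 (N' * p)) 2) :=
    finiteDimensional_cuspForm_gamma0 (N' * p) 2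
  haveI : FiniteDimensional ℂ (CuspForm (Gamma0 (N' * p)) (2 + w)) :=
    finiteDimensional_cuspForm_gamma0 (N' * p) (2 + w)
  obtain ⟨O, hO⟩ := exists_valuationSubring_norm ι
  obtain ⟨n₂, b₂, θ₂, lvl₂, _, nf₂, -, -, hθa₂, hθ₂, htri₂, hcount₂⟩ :=
    exists_triangular_basis ι N' hpN' 2 le_rfl
  obtain ⟨n, b, θ, lvl, _, nf, -, -, hθa, hθ, htri, hcount⟩ :=
    exists_triangular_basis ι N' hpN' (2 + w) (by omega)
  -- the congruence predicate
  obtain ⟨C, hC⟩ : ∃ C : (κ : ℤ) → (M : ℕ) → CuspForm (Gamma0 M) κ → Prop,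
      ∀ κ M (f : CuspForm (Gamma0 M) κ), C κ M f ↔
        ∀ q : ℕ, q.Prime → ¬ q ∣ A → ‖ι.symm ((qExpansion 1 ⇑f).coeff q) - c q‖ < 1 :=
    ⟨_, fun _ _ _ ↦ Iff.rfl⟩
  rw [← hcount (C (2 + w)) r s
      (fun M _ hM ↦ (hr M hM).trans (congrArg Set.ncard (Set.ext fun f ↦ by
        simp only [Set.mem_setOf_eq, hC])))
      (fun M _ hM ↦ (hs M hM).trans (congrArg Set.ncard (Set.ext fun f ↦ by
        simp only [Set.mem_setOf_eq, hC]))),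
    ← hcount₂ (C 2) r₂ s₂
      (fun M _ hM ↦ (hr₂ M hM).trans (congrArg Set.ncard (Set.ext fun f ↦ by
        simp only [Set.mem_setOf_eq, hC])))
      (fun M _ hM ↦ (hs₂ M hM).trans (congrArg Set.ncard (Set.ext fun f ↦ by
        simp only [Set.mem_setOf_eq, hC])))]
  -- ### the primes `S` and the residual characters
  have hS : ∀ q, (q.Prime ∧ (¬ q ∣ A ∨ q = p)) → q.Prime := fun q h ↦ h.1
  have hSN' : ∀ q, (q.Prime ∧ (¬ q ∣ A ∨ q = p)) → (¬ q ∣ N' * p ∨ q = p) := fun q h ↦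
    h.2.imp_left fun h1 h2 ↦ h1 (h2.trans hA)
  have hqp : ∀ q, ¬ q ∣ A → q ≠ p := fun q hq h ↦ hq (h ▸ (dvd_mul_left p N').trans hA)
  set ψ₂ : Fin n₂ → {q : ℕ // q.Prime ∧ (¬ q ∣ A ∨ q = p)} → ResidueField O :=
    fun i t ↦ residue O ⟨θ₂ i t.1, (hO _).mpr (hθ₂ i t.1 t.2.1)⟩ with hψ₂
  set ψ : Fin n → {q : ℕ // q.Prime ∧ (¬ q ∣ A ∨ q = p)} → ResidueField O :=
    fun i t ↦ residue O ⟨θ i t.1, (hO _).mpr (hθ i t.1 t.2.1)⟩ with hψ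
  have hcO : ∀ t : {q : ℕ // q.Prime ∧ (¬ q ∣ A ∨ q = p)}, ι (c t.1) ∈ O := fun t ↦ by
    rw [hO, RingEquiv.symm_apply_apply]; exact hc _ t.2.1
  set tp : {q : ℕ // q.Prime ∧ (¬ q ∣ A ∨ q = p)} := ⟨p, hp, Or.inr rfl⟩ with htp
  obtain ⟨P, hP⟩ : ∃ P : ({q : ℕ // q.Prime ∧ (¬ q ∣ A ∨ q = p)} → ResidueField O) → Prop,
      ∀ χ, P χ ↔ (∀ t, ¬ t.1 ∣ A → χ t = residue O ⟨ι (c t.1), hcO t⟩) ∧ χ tp ≠ 0 :=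
    ⟨_, fun _ ↦ Iff.rfl⟩
  -- ### translation of the counted sets
  have key : ∀ {m : ℕ} (θ' : Fin m → ℕ → ℂ) (hθ' : ∀ i q, q.Prime → ‖ι.symm (θ' i q)‖ ≤ 1)
      (lvl' : Fin m → ℕ) (κ : ℤ) (nf' : ∀ i, CuspForm (Gamma0 (lvl' i)) κ)
      (_ : ∀ i q, q ≠ p → θ' i q = (qExpansion 1 ⇑(nf' i)).coeff q) (i : Fin m),
      (C κ (lvl' i) (nf' i) ∧ ‖ι.symm (θ' i p)‖ = 1) ↔
        P (fun t ↦ residue O ⟨θ' i t.1, (hO _).mpr (hθ' i t.1 t.2.1)⟩) := by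
    intro m θ' hθ' lvl' κ nf' hθa' i
    rw [hP, hC]
    refine and_congr ⟨fun h t ht ↦ ?_, fun h q hq hqA ↦ ?_⟩ ?_
    · rw [residue_eq_iff_norm ι hO]
      change ‖ι.symm (θ' i t.1) - ι.symm (ι (c t.1))‖ < 1
      rw [RingEquiv.symm_apply_apply, hθa' i t.1 (hqp t.1 ht)]
      exact h t.1 t.2.1 ht
    · have h' := h ⟨q, hq, Or.inl hqA⟩ hqA
      rw [residue_eq_iff_norm ι hO] at h'
      change ‖ι.symm (θ' i q) - ι.symm (ι (c q))‖ < 1 at h'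
      rw [RingEquiv.symm_apply_apply, hθa' i q (hqp q hqA)] at h'
      exact h'
    · change ‖ι.symm (θ' i p)‖ = 1 ↔ residue O ⟨θ' i p, (hO _).mpr (hθ' i p hp)⟩ ≠ 0
      exact (residue_ne_zero_iff_norm ι hO ⟨θ' i p, (hO _).mpr (hθ' i p hp)⟩).symm
  have hset : {i : Fin n | C (2 + w) (lvl i) (nf i) ∧ ‖ι.symm (θ i p)‖ = 1} =
      ↑(Finset.univ.filter fun i ↦ P (ψ i)) := by
    ext i
    simp only [Set.mem_setOf_eq, Finset.coe_filter, Finset.mem_univ, true_and]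
    exact key θ hθ lvl (2 + w) nf hθa i
  have hset₂ : {i : Fin n₂ | C 2 (lvl₂ i) (nf₂ i) ∧ ‖ι.symm (θ₂ i p)‖ = 1} =
      ↑(Finset.univ.filter fun i ↦ P (ψ₂ i)) := by
    ext i
    simp only [Set.mem_setOf_eq, Finset.coe_filter, Finset.mem_univ, true_and]
    exact key θ₂ hθ₂ lvl₂ 2 nf₂ hθa₂ i
  rw [hset, hset₂, Set.ncard_coe_finset, Set.ncard_coe_finset]
  -- ### the count transfer
  refine (card_filter_comp_eq_of_forall_le ψ₂ ψ (fun χ ↦ χ tp ≠ 0) (fun χ ↦ ?_) (le_of_eq ?_) P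
    (fun χ hχ ↦ ((hP χ).mp hχ).2)).symm
  · -- `· E_w`
    exact card_residual_le_of_eisenstein ι hO hw3 hwe hpw (fun q ↦ q.Prime ∧ (¬ q ∣ A ∨ q = p)) hS
      b₂ θ₂ (fun i q hq ↦ hθ₂ i q hq.1) (fun q hq i ↦ htri₂ q hq.1 (hSN' q hq) i) b θ
      (fun i q hq ↦ hθ i q hq.1) (fun q hq i ↦ htri q hq.1 (hSN' q hq) i) χ
  · -- rank constancy
    calc (Finset.univ.filter fun i ↦ ψ i tp ≠ 0).card
        = (Finset.univ.filter fun i ↦ ‖ι.symm (θ i p)‖ = 1).card :=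
          congrArg Finset.card (Finset.filter_congr fun i _ ↦
            residue_ne_zero_iff_norm ι hO ⟨θ i p, (hO _).mpr (hθ i p hp)⟩)
      _ = finrank ℂ ↥(⨆ (u : ℂ) (_ : ‖ι.symm u‖ = 1),
            (heckeT (Gamma0 (N' * p)) (2 + w) p).maxGenEigenspace u) :=
          (finrank_biSup_maxGenEigenspace_eq_card ι b _ (fun i ↦ θ i p) (htri p hp (Or.inr rfl))).symm
      _ = finrank ℂ ↥(⨆ (u : ℂ) (_ : ‖ι.symm u‖ = 1),
            (heckeT (Gamma0 (N' * p)) 2 p).maxGenEigenspace u) := hRC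
      _ = (Finset.univ.filter fun i ↦ ‖ι.symm (θ₂ i p)‖ = 1).card :=
          finrank_biSup_maxGenEigenspace_eq_card ι b₂ _ (fun i ↦ θ₂ i p) (htri₂ p hp (Or.inr rfl))
      _ = (Finset.univ.filter fun i ↦ ψ₂ i tp ≠ 0).card :=
          congrArg Finset.card (Finset.filter_congr fun i _ ↦
            (residue_ne_zero_iff_norm ι hO ⟨θ₂ i p, (hO _).mpr (hθ₂ i p hp)⟩).symm)

end Count

/-! ### The congruent ordinary newform of level exactly `N` -/

section LevelN

variable {p : ℕ} [Fact p.Prime]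

/-- **From rank constancy at the levels `N' p`, `N' ∣ N`, to a congruent `p`-ordinary newform of
weight `2 + w` and level EXACTLY `N`.**  For `p ∤ N`, `w ≥ 3` even with `(p-1) ∣ w`, a `p`-ordinary
newform `f ∈ S_2(Γ₀(N))` congruent to the target system `c` at the primes `q ∤ N p`, and rank
constancy between the weights `2 + w` and `2` at every level `N' p` (`N' ∣ N`), there is a
`p`-ordinary newform `g ∈ S_{2+w}(Γ₀(N))` congruent to `c` at the primes `q ∤ N p`.  Proof: by
`sum_divisors_count_eq_of_rank_eq`, `∑_{M ∣ N'} σ₀(N'/M) (r_{2+w}(M) + s_{2+w}(M) - r_2(M) - s_2(M)) = 0`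
for all `N' ∣ N`, whence `r_{2+w}(N) + s_{2+w}(N) = r_2(N) + s_2(N)`
(`eq_zero_of_sum_divisors_card_mul_eq_zero`); `s_{2+w}(N) = 0` because a newform of level `N p`
and weight `> 2` has `a_p² = p^{w}` (`IsNewform0.coeff_sq_eq_of_exactly_dvd`), and `r_2(N) ≥ 1`
on account of `f`. [cite: Hida2022EMI, Lemma 4.1.25] [cite: Hida1986, Cor. 1.3] -/
theorem exists_isNewform0_congr_of_rank_constancy (ι : PadicAlgCl p ≃+* ℂ) {N : ℕ} [NeZero N]
    (hpN : ¬ p ∣ N) {w : ℕ} (hw3 : 3 ≤ w) (hwe : Even w) (hpw : (p - 1) ∣ w)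
    (hRC : ∀ (N' : ℕ) [NeZero N'], N' ∣ N →
      (haveI : NeZero p := ⟨(Fact.out : p.Prime).ne_zero⟩;
        finrank ℂ ↥(⨆ (u : ℂ) (_ : ‖ι.symm u‖ = 1),
            (heckeT (Gamma0 (N' * p)) (2 + w) p).maxGenEigenspace u) =
          finrank ℂ ↥(⨆ (u : ℂ) (_ : ‖ι.symm u‖ = 1),
            (heckeT (Gamma0 (N' * p)) 2 p).maxGenEigenspace u)))
    (c : ℕ → PadicAlgCl p) (hc : ∀ q, q.Prime → ‖c q‖ ≤ 1)
    (f : CuspForm (Gamma0 N) 2) (hf : IsNewform0 f) (hfp : ‖ι.symm ((qExpansion 1 ⇑f).coeff p)‖ = 1)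
    (hfc : ∀ q : ℕ, q.Prime → ¬ q ∣ N * p → ‖ι.symm ((qExpansion 1 ⇑f).coeff q) - c q‖ < 1) :
    ∃ g : CuspForm (Gamma0 N) (2 + w), IsNewform0 g ∧ ‖ι.symm ((qExpansion 1 ⇑g).coeff p)‖ = 1 ∧
      ∀ q : ℕ, q.Prime → ¬ q ∣ N * p → ‖ι.symm ((qExpansion 1 ⇑g).coeff q) - c q‖ < 1 := by
  classical
  have hp : p.Prime := Fact.out
  haveI : NeZero p := ⟨hp.ne_zero⟩
  -- the counting functions `r κ M` (`s κ M = r κ (M p)`)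
  obtain ⟨r, hr⟩ : ∃ r : ℤ → ℕ → ℕ, ∀ (κ : ℤ) (M : ℕ) [NeZero M], r κ M =
      {f : CuspForm (Gamma0 M) κ | IsNewform0 f ∧
        (∀ q : ℕ, q.Prime → ¬ q ∣ N * p → ‖ι.symm ((qExpansion 1 ⇑f).coeff q) - c q‖ < 1) ∧
        ‖ι.symm ((qExpansion 1 ⇑f).coeff p)‖ = 1}.ncard :=
    ⟨fun κ M ↦ if h : M = 0 then 0 else (haveI : NeZero M := ⟨h⟩;
        {f : CuspForm (Gamma0 M) κ | IsNewform0 f ∧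
          (∀ q : ℕ, q.Prime → ¬ q ∣ N * p → ‖ι.symm ((qExpansion 1 ⇑f).coeff q) - c q‖ < 1) ∧
          ‖ι.symm ((qExpansion 1 ⇑f).coeff p)‖ = 1}.ncard),
      fun κ M _ ↦ by dsimp only; rw [dif_neg (NeZero.ne M)]⟩
  -- ### the count identity at every level `N' ∣ N`
  have hsum : ∀ N', N' ∣ N → ∑ M ∈ N'.divisors, ((N' / M).divisors.card : ℤ) *
      (((r (2 + w) M + r (2 + w) (M * p) : ℕ) : ℤ) - ((r 2 M + r 2 (M * p) : ℕ) : ℤ)) = 0 := by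
    intro N' hN'
    haveI : NeZero N' := ⟨ne_zero_of_dvd_ne_zero (NeZero.ne N) hN'⟩
    have hpN' : ¬ p ∣ N' := fun h ↦ hpN (h.trans hN')
    have h := sum_divisors_count_eq_of_rank_eq ι hpN' (mul_dvd_mul_right hN' p) hw3 hwe hpw c hc
      (hRC N' hN') (r 2) (fun M ↦ r 2 (M * p)) (r (2 + w)) (fun M ↦ r (2 + w) (M * p))
      (fun M _ _ ↦ hr 2 M) (fun M _ _ ↦ hr 2 (M * p)) (fun M _ _ ↦ hr (2 + w) M)
      (fun M _ _ ↦ hr (2 + w) (M * p))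
    simp only [mul_sub, Finset.sum_sub_distrib, sub_eq_zero]
    exact_mod_cast h
  have hN := eq_zero_of_sum_divisors_card_mul_eq_zero (NeZero.ne N) _ hsum N dvd_rfl
  rw [sub_eq_zero, Nat.cast_inj] at hN
  -- ### `s_{2+w}(N) = 0`
  have hs0 : r (2 + w) (N * p) = 0 := by
    rw [hr, Set.ncard_eq_zero ((finite_newforms0_holds (N * p) (2 + w)).subset fun g hg ↦ hg.1)]
    ext g
    simp only [Set.mem_setOf_eq, Set.mem_empty_iff_false, iff_false, not_and]
    intro hg _ hunit
    have hsq := IsNewform0.coeff_sq_eq_of_exactly_dvd (mul_comm N p) hpN hg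
    have h1 : ‖ι.symm ((qExpansion 1 ⇑g).coeff p)‖ ^ 2 = ‖(p : PadicAlgCl p)‖ ^ w := by
      rw [← norm_pow, ← map_pow, hsq, show (2 + (w : ℤ) - 2) = (w : ℤ) by ring, zpow_natCast,
        map_pow, map_natCast, norm_pow]
    rw [hunit, one_pow] at h1
    have h2 : ‖(p : PadicAlgCl p)‖ ^ w < 1 :=
      pow_lt_one₀ (norm_nonneg _) (Automorphic.PadicAlgCl.norm_natCast_p_lt_one p) (by omega)
    rw [← h1] at h2
    exact lt_irrefl _ h2
  -- ### `r_2(N) ≥ 1`, hence `r_{2+w}(N) ≥ 1`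
  have hr2 : 0 < r 2 N := by
    rw [hr, Set.ncard_pos ((finite_newforms0_holds N 2).subset fun g hg ↦ hg.1)]
    exact ⟨f, hf, hfc, hfp⟩
  have hrk : r (2 + w) N ≠ 0 := by omega
  rw [hr] at hrk
  obtain ⟨g, hg, hgc, hgp⟩ := Set.nonempty_of_ncard_ne_zero hrk
  exact ⟨g, hg, hgp, hgc⟩

end LevelN

end Literature.NumberTheory.EllipticCurves.ModularForms.HidaRank

/-! ### Assembly: Modularity + rank constancy ⇒ the named fact -/

namespace Literature.NumberTheory.EllipticCurves

open Literature.NumberTheory.EllipticCurves.ModularForms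
open Literature.NumberTheory.EllipticCurves.ModularForms.HidaRank

/-- **`hida_exists_congruent_ordinary_newform` from the Modularity Theorem and Hida's rank
constancy.**  The first hypothesis is the named fact `exists_isNewformOf` (Breuil–Conrad–Diamond–
Taylor 2001, Thm. A).  The second is Hida's RANK CONSTANCY in the printed form of Hida,
*Elementary Modular Iwasawa Theory*, Lemma 4.1.25 (= Cor. 4.2.32; Hida, Invent. Math. 85 (1986) and
Ann. Sci. ÉNS 19 (1986)), special case of trivial nebentypus `ψ ω^{-k} = 𝟙` (`ψ = ω²`,
`k ≡ 2 (mod p - 1)`): for `p ≥ 5`, `p ∤ N`, `k ≥ 2` with `(p - 1) ∣ (k - 2)`, the number of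
`p`-adic unit eigenvalues of `U_p` on `S_k(Γ₀(N p))`, counted with multiplicity — the `W`-rank of
the ordinary part `S_k^{ord}(Γ₀(N p); W)` — equals the same number in weight `2`.  GIVEN these, the
named fact follows by the classical arguments of this file: Deligne–Serre's congruence
`f E_{k-2} ≡ f`, integral coordinates and decomposition numbers modulo `𝔪`, Atkin–Lehner theory
and `a_p² = p^{k-2}` at level `N p`, and a triangular induction over the divisors of `N`
(`exists_isNewform0_congr_of_rank_constancy`), together with the modularity dictionary
`a_ℓ(f_E) = a_ℓ(E)` (`LFunction_apply_prime_eq_frobeniusTrace`), `p ∤ N_E`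
(`not_dvd_level_of_isNewformOf`), `|a_p(E)|_p = 1` for ordinary `p`.  No `_holds` is claimed.
[cite: Hida2022EMI, Lemma 4.1.25, Cor. 4.2.32] [cite: Hida1986, Thm. 1.1–1.2, Cor. 1.3]
[cite: BreuilConradDiamondTaylor2001, Thm. A] [cite: DeligneSerreASENS1974, 6.9–6.11] -/
theorem hida_exists_congruent_ordinary_newform_of_exists_isNewformOf_of_rank_constancy
    (hmod : exists_isNewformOf)
    (hRC : ∀ (p : ℕ) [Fact p.Prime] (ι : PadicAlgCl p ≃+* ℂ) (N : ℕ) [NeZero N], 5 ≤ p →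
      ¬ p ∣ N → ∀ k : ℤ, 2 ≤ k → ((p : ℤ) - 1) ∣ (k - 2) →
      (haveI : NeZero p := ⟨(Fact.out : p.Prime).ne_zero⟩;
        finrank ℂ ↥(⨆ (u : ℂ) (_ : ‖ι.symm u‖ = 1),
            (heckeT (Gamma0 (N * p)) k p).maxGenEigenspace u) =
          finrank ℂ ↥(⨆ (u : ℂ) (_ : ‖ι.symm u‖ = 1),
            (heckeT (Gamma0 (N * p)) 2 p).maxGenEigenspace u))) :
    hida_exists_congruent_ordinary_newform := by
  intro W _ _ hNz p _ hp5 hgood hord k hk hpk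
  haveI := hNz
  have hp : p.Prime := Fact.out
  -- the weight `k = 2 + w`, `w ≥ 3` even and divisible by `p - 1`
  obtain ⟨w, rfl⟩ : ∃ w : ℕ, k = 2 + (w : ℤ) := ⟨(k - 2).toNat, by omega⟩
  have hpw : (p - 1) ∣ w := by
    have h1 : ((p - 1 : ℕ) : ℤ) ∣ (w : ℤ) := by
      rw [Nat.cast_sub hp.one_le]
      simpa using hpk
    exact_mod_cast h1
  have hw0 : w ≠ 0 := by omega
  have hw3 : 3 ≤ w := by
    have := Nat.le_of_dvd (Nat.pos_of_ne_zero hw0) hpw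
    omega
  have hwe : Even w :=
    (even_iff_two_dvd.mp (hp.even_sub_one (by omega))).trans hpw |> even_iff_two_dvd.mpr
  -- modularity: the newform `f_E`, `a_ℓ(f_E) = a_ℓ(E)`, `p ∤ N`, `a_p(f_E)` a `p`-adic unit
  obtain ⟨f, hf⟩ := hmod W
  have hpN : ¬ p ∣ W.conductorNorm ℤ := not_dvd_level_of_isNewformOf hf hgood
  have hfℓ : ∀ (ℓ : ℕ) [Fact ℓ.Prime], W.HasGoodReductionAtPrime ℓ →
      (qExpansion 1 ⇑f).coeff ℓ = (W.frobeniusTrace ℓ : ℂ) := by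
    intro ℓ _ hℓ
    rw [← WeierstrassCurve.LFunction_apply_prime_eq_frobeniusTrace W ℓ hℓ]
    exact hf.2 ℓ
  obtain ⟨ι₀⟩ := PadicAlgCl.nonempty_ringEquiv_complex p
  have hιf : ∀ (ℓ : ℕ) [Fact ℓ.Prime], W.HasGoodReductionAtPrime ℓ →
      ι₀.symm ((qExpansion 1 ⇑f).coeff ℓ) = ((W.frobeniusTrace ℓ : ℤ) : PadicAlgCl p) := by
    intro ℓ _ hℓ
    rw [hfℓ ℓ hℓ, map_intCast]
  have hordf : ‖ι₀.symm ((qExpansion 1 ⇑f).coeff p)‖ = 1 := by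
    rw [hιf p hgood]
    exact DeligneSerreLift.norm_intCast_eq_one_of_not_dvd hord
  -- the target system `c ℓ = a_ℓ(E)`
  have hfc : ∀ q : ℕ, q.Prime → ¬ q ∣ W.conductorNorm ℤ * p →
      ‖ι₀.symm ((qExpansion 1 ⇑f).coeff q) - ((W.frobeniusTrace q : ℤ) : PadicAlgCl p)‖ < 1 := by
    intro q hq hqNp
    have hqN : ¬ q ∣ W.conductorNorm ℤ := fun h' ↦ hqNp (h'.mul_right p)
    haveI : Fact q.Prime := ⟨hq⟩
    rw [hιf q (hasGoodReductionAtPrime_of_not_dvd_conductorNorm W hqN), sub_self, norm_zero]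
    exact one_pos
  -- rank constancy ⇒ the congruent ordinary newform of level `N`
  obtain ⟨g, hgnew, hgp, hgc⟩ := exists_isNewform0_congr_of_rank_constancy ι₀ hpN hw3 hwe hpw
    (fun N' _ hN' ↦ hRC p ι₀ N' hp5 (fun h ↦ hpN (h.trans hN')) (2 + (w : ℤ)) (by omega) hpk)
    (fun q ↦ ((W.frobeniusTrace q : ℤ) : PadicAlgCl p))
    (fun q _ ↦ DeligneSerreLift.norm_intCast_le_one _) f hf.1 hordf hfc
  let ι : coeffField g →+* PadicAlgCl p :=
    (ι₀.symm : ℂ →+* PadicAlgCl p).comp (algebraMap (coeffField g) ℂ)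
  have hι : ∀ (x : ℂ) (hx : x ∈ coeffField g), ι ⟨x, hx⟩ = ι₀.symm x := fun _ _ ↦ rfl
  refine ⟨g, ι, hgnew, by rw [hι]; exact hgp, fun ℓ hℓ hℓNp ↦ ?_⟩
  rw [hι]
  exact hgc ℓ hℓ hℓNp

end Literature.NumberTheory.EllipticCurves

end
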